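import Literature.Computability.AlgebraicComplexity.TwoRowRectangleKronecker
import Literature.Computability.AlgebraicComplexity.IP17KroneckerPositivityProofs
import Literature.RepresentationTheory.FiniteGroups.SymmetricGroupIsotypic
import Literature.RingTheory.SymmetricFunctions.SchurColumn
import Literature.NumberTheory.DiophantineGeometry.SymmetricGroupRepsSignTwist
import HarnessLib

/-!
# Kronecker coefficients of a hook and two equal rectangles:
# `g((nd-k, 1^k), d × n, d × n) = #{k as a sum of distinct parts from {3, 5, …, 2d-1}}`
# (Ikenmeyer–Panova 2017, Prop. 6.4 — discharge of `ikenmeyerPanova2017_prop_6_4` and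
# `ikenmeyerPanova2017_cor_5_1`)

Topic `Literature/Computability/AlgebraicComplexity`; a PROOFS file (D-0014) for the statement file
`IP17KroneckerPositivity.lean` (C. Ikenmeyer, G. Panova, *Rectangular Kronecker coefficients and
plethysms in geometric complexity theory*, Adv. Math. 319 (2017) 40–66 = arXiv:1512.03798, key
`IkenmeyerPanova2017`). It discharges the named facts

* `ikenmeyerPanova2017_prop_6_4` — **Prop. 6.4** (TeX L1381–1385; held: Proposition 31, chunk
  p0015): "the Kronecker coefficients `g((nd-k,1^k), d × n, d × n)` are equal to the number of
  partitions of `k` into distinct parts from `{3, 5, …, 2d-1}` [for `d ≤ n`]. In other words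
  `∑_{k=0}^{nd-1} g_k(d,n) q^k = ∏_{i=2}^{d} (1 + q^{2i-1})`" — `ikenmeyerPanova2017_prop_6_4_holds`;
* `ikenmeyerPanova2017_cor_5_1` — **Cor. 5.1** (`a_ρ = 0 ⇔ ρ ∈ 𝔛`), through the tree's reduction
  `ikenmeyerPanova2017_cor_5_1_of_prop_6_4` (`IP17KroneckerPositivityProofs.lean`) —
  `ikenmeyerPanova2017_cor_5_1_holds`;

and thereby makes the conditional theorems `ikenmeyerPanova2017_thm_6_1_zero / _table / _symm`
of the statement file unconditional (feed them `ikenmeyerPanova2017_prop_6_4_holds`). No statement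
of the tree is changed and no named fact is introduced; the four small `def`s of the sub-namespace
`IP17Hook` (`signedFix`, `signedFixCount`, `hookVec`, `conjVec`) are proof plumbing with bodies.

Honest framing (cell val-lit, seat t02): classical combinatorics of characters of the symmetric
group and of Kronecker coefficients at rectangles; VP ≠ VNP is NOT proved and nothing here bears
on it.

## The printed proof and how it is followed (TeX L1386–1428)

Ikenmeyer–Panova: "denote by `ν^k := (nd-k, 1^k)` the hook partition and `μ := (d^n)`, where
`d ≤ n`. By Littlewood's identity we have `s_μ * (s_{1^k} s_{(N-k)}) = ∑ c^μ_{αβ} c^γ_{α'β} s_γ` …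
Since `s_{(1^k)} s_{(N-k)} = s_{(N-k,1^k)} + s_{(N-k+1,1^{k-1})}`, we have (6.6)
`g(ν^k, μ, μ) + g(ν^{k-1}, μ, μ) = ∑ c^μ_{αβ} c^μ_{α'β}` … for `μ = (d^n)` we have
`c^{(d×n)}_{δγ} = 1` iff `δ, γ` complement each other inside the rectangle … [so the sum counts]
the partitions `θ ⊢ k` such that `θ = θᵀ` and `θ ⊂ (d × n)` … (6.7) such `θ` are in bijection with
partitions of `k` into distinct odd parts `2i - 1`, `i ≤ d` [diagonal hooks] … `G(q) + q G(q) =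
∏_{i=1}^{d}(1 + q^{2i-1})`, so `G(q) = ∏_{i=2}^{d} (1 + q^{2i-1})`." The file mirrors this through
CHARACTERS of `𝔖_D` (`D = nd`), with Frobenius's formula as the bridge to Schur polynomials (the
architecture of the sibling `TwoRowRectangleKronecker.lean`, which treats `s_k s_{N-k}`; here the
second fibre carries the SIGN character):

1. **Signed Burnside** (`sum_sign_mul_sum_fixed_prod_eq`): `∑_{π} sign(π) F_π(z) = s!·e_s(z)` (only
   injective words have a non-trivially-signed stabiliser); the signed stabiliser sum of a two-letter
   word `∑_{σ ∈ Stab w} sign(σ|_{w⁻¹(1)}) F_σ(z) = c₀! c₁! h_{c₀}(z) e_{c₁}(z)`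
   (`sum_stab_sign_mul_fixedEnum`).
2. **Pieri's rule for characters** (`IP17Hook.spechtCharacter_hook_add_spechtCharacter_hook`):
   `χ^{(D-k,1^k)} + χ^{(D-k+1,1^{k-1})} = ψ'_k`, `ψ'_k(σ) = ∑_{|S|=k, σS=S} sign(σ|_S)` (the character
   of `Λ^k ℂ^D`), `1 ≤ k ≤ D-1`: the Fourier coefficients `⟨ψ'_k, χ^μ⟩` are computed by Frobenius's
   formula in `D` letters (`spechtCharacter_eq_frobeniusChar`), `a_ρ h_{D-k} = a_{(D-k)+ρ}`
   (`s_{(r)} = h_r`, `schur_oneRow_eq_hsymm`) and the dual Pieri rule `e_k a_μ = ∑_{|S|=k} a_{μ+1_S}`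
   (`esymm_mul_alternant`), of which exactly the two hooks survive
   (`IP17Hook.coeff_sum_alternant_addOn_oneRow`); then completeness
   (`IsClassFun.eq_sum_classInner_smul`, `irrChars_toFinset_perm_eq`).
3. **(6.5)–(6.6), the master formula** (`kroneckerCoeff_hook_add_hook_eq`): for any two rectangles
   `R = (aᵇ)`, `R' = (cᵈ)`: `g(R,R',h_k) + g(R,R',h_{k-1}) = E'(D-k,k) := [x^{a𝟙+ρ_b} y^{c𝟙+ρ_d}]
   (a_{ρ_b}(x) a_{ρ_d}(y) h_{D-k}(x⊗y) e_k(x⊗y))` (character formula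
   `kroneckerCoeff_eq_sum_spechtCharacter_holds`, step 2, orbit–stabiliser, step 1 and Frobenius's
   formula for both rectangles).
4. **The dual Cauchy identity** at the generic point of `ℤ[y][x]`
   (`IP17Hook.sum_powersetCard_prod_eq_sum_schur_mul_schur_conjVec`): `e_s(x⊗y) = ∑_{α ⊢ s, α₁ ≤ n}
   s_α(x) s_{αᵀ}(y)`, from (i) the alternant expansion `a_ρ F_π = ∑_γ X^γ(π) a_{γ+ρ}`
   (`alternant_mul_fixedWordPoly_eq_sum`, an antisymmetric-coefficient argument) and (ii) the
   signed orthogonality `∑_π sign(π) X^λ(π) X^μ(π) = s!·[λ₁ ≤ n ∧ μ = λᵀ]`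
   (`IP17Hook.sum_sign_mul_frobeniusChar_mul_frobeniusChar`: `χ^{λᵀ} = sgn ⊗ χ^λ`,
   `spechtCharacter_transpose`, and orthonormality), the conjugate weight being
   `IP17Hook.conjVec n λ` (`= λᵀ` padded, `IP17Hook.getD_sortedParts_transpose_eq_conjVec`).
5. **Rectangle Littlewood–Richardson** (`coeff_coeff_rect_hook_eq_card`): with Cauchy
   (`sum_piAntidiag_prod_pow_eq_sum_schur_mul_schur`) and step 4, `E'(r,s)` for two equal rectangles
   `(aⁿ)` is `∑_{β,α} c^{(aⁿ)}_{βα} c^{(aⁿ)}_{βαᵀ} = #{α ⊢ s antitone in n letters : α ⊆ (aⁿ), αᵀ = α}`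
   (`coeff_rect_alternant_mul_schur`).
6. **(6.7), self-conjugate ↔ distinct odd parts** (`IP17Hook.card_selfConj_eq_oddPartsSubsetCount`):
   `#{α ∈ ℕⁿ antitone, |α| = s, αᵀ = α} = oddPartsSubsetCount 1 n s`, by induction on `n` (remove the
   outer hook of length `2n - 1` when `α₁ = n`, else drop the empty last row).
7. **Assembly** (`kroneckerCoeff_rectangle_rectangle_hook`, `ikenmeyerPanova2017_prop_6_4_holds`):
   induction on `k` with `g((D), R, R) = 1` and `oddPartsSubsetCount 1 d k =
   oddPartsSubsetCount 2 d k + oddPartsSubsetCount 2 d (k-1)` (`oddPartsSubsetCount_one_succ`,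
   IP's `G(q) + qG(q)`).

Deviation from print: none in substance; the symmetric-function identities are used in their
`𝔖_D`-character form (Frobenius), as in the sibling file, because the tree's Kronecker coefficients
are defined through Specht modules.

## References

* [IkenmeyerPanova2017] C. Ikenmeyer, G. Panova, Adv. Math. 319 (2017) 40–66 = arXiv:1512.03798,
  Prop. 6.4 and its proof, (6.5)–(6.7) (TeX L1381–1428; held `paper:arxiv-1512.03798`,
  Proposition 31, chunk p0015); Cor. 5.1 (TeX L1219).
* [FultonHarrisGTM129] W. Fulton, J. Harris, *Representation Theory*, GTM 129 (1991), §3.2 and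
  Exercise 4.6 (`Λ^k V` for the standard representation), Thm. 4.10, §4.3 (4.33), (4.41),
  Exercise 4.51.
* [Macdonald1995] I. G. Macdonald, *Symmetric Functions and Hall Polynomials*, 2nd ed. (1995),
  Ch. I §1 (1.3) (conjugate partition), §2 (2.14'), §3 (3.4), §4 (4.3') (dual Cauchy), §5 (5.16)
  (Pieri), §7 (7.8).
* [JamesLNM682] G. D. James, *The Representation Theory of the Symmetric Groups*, LNM 682 (1978),
  6.6 (`χ^{λ'} = χ^λ ⊗ sgn`).

## Mathlib and tree

Mathlib: `Equiv.Perm.subtypePerm`, `Equiv.Perm.sign_permCongr`, `DomMulAct.stabilizer_card`,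
`Finset.sum_involution`, `Fintype.card_equiv`, `MvPolynomial.coeff_rename_mapDomain`,
`MvPolynomial.IsHomogeneous`, `Matrix.det_permute`, `Matrix.det_of_upperTriangular`, `Fin.cons`,
`Fin.sum_univ_castSucc`. Tree: `TwoRowRectangleKronecker` (`sum_fixed_mul_sum_fixed'`,
`ringHom_fixedWordPoly`, `coeff_coeff_map_mul_C'`, `sum_piAntidiag_prod_pow_eq_sum_schur_mul_schur`),
`SymmetricGroupFrobeniusFormula/Orthogonality/FixedWords` (`spechtCharacter_eq_frobeniusChar`,
`frobeniusChar`, `fixedWordPoly`, `sum_perm_sum_fixed_prod_eq`, `sum_card_stab_eq_factorial_of_content`,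
`coeff_alternant_X`), `SchurPolynomials` / `SchurColumn` / `RectangleLittlewoodRichardson`
(`alternant_add_rho`, `esymm_mul_alternant`, `antitoneWeights`, `exists_antitone_add_rho_comp_perm`,
`coeff_add_rho_alternant_X_add_rho`, `coeff_rect_alternant_mul_schur`, `boxCompl_mem_antitoneWeights`,
`card_filter_lt_of_le`), `IrreducibleCharacters` / `SymmetricGroupIsotypic` (`classInner`,
`IsClassFun.eq_sum_classInner_smul`, `irrChars_toFinset_perm_eq`, `spechtCharacter_injective`,
`IsIrrChar.classInner_eq`), `SymmetricGroupRepsSignTwist` (`spechtCharacter_transpose`),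
`GLHighestWeightFacts` (`Weight.ofPartition_injOn_holds`, `Weight.existsUnique_eq_ofPartition_holds`),
`OccurrenceObstructionsIPExtension` (`lt_getD_transpose_iff`, `card_parts_transpose_eq`),
`GCTMatrixPoweringProp17OnlyIf` (`kroneckerCoeff_indiscrete_eq`), `IP17KroneckerPositivity(Proofs)`
(`oddPartsSubsetCount`, `oddPartsSubsetCount_one_succ`, `ikenmeyerPanova2017_cor_5_1_of_prop_6_4`).
-/

noncomputable section

open scoped BigOperators
open MvPolynomial Finset Equiv
open Literature.RingTheory.SymmetricFunctions.SymmPoly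
open Literature.RepresentationTheory.FiniteGroups
open Literature.NumberTheory.DiophantineGeometry

namespace Literature.Computability.AlgebraicComplexity

/-! ### 1. Signed Burnside: `∑_π sign(π) F_π(z) = |ι|! · e_{|ι|}(z)` -/

/-- For a word `u`, the signed sum over its stabiliser `∑_{π : u ∘ π = u} sign(π)` is `1` if `u` is
injective (the stabiliser is trivial) and `0` otherwise (a transposition of two equal letters lies
in the stabiliser and reverses signs). [folklore] -/
private theorem sum_stab_sign_eq_ite {ι α : Type*} [Fintype ι] [DecidableEq ι] [DecidableEq α]
    {R : Type*} [CommRing R] (u : ι → α) :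
    ∑ π ∈ univ.filter (fun π : Perm ι => u ∘ ⇑π = u), ((Equiv.Perm.sign π : ℤ) : R) =
      if Function.Injective u then 1 else 0 := by
  classical
  split_ifs with hu
  · have h1 : (univ.filter fun π : Perm ι => u ∘ ⇑π = u) = {1} := by
      ext π
      simp only [mem_filter, mem_univ, true_and, mem_singleton]
      constructor
      · intro h
        ext q
        have := hu (congr_fun h q)
        simpa using this
      · rintro rfl
        rfl
    rw [h1, Finset.sum_singleton, Equiv.Perm.sign_one]
    simp
  · simp only [Function.Injective, not_forall, exists_prop] at hu
    obtain ⟨p, q, hpq, hne⟩ := hu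
    refine Finset.sum_involution (fun π _ => Equiv.swap p q * π) ?_ ?_ ?_ ?_
    · intro π _
      rw [Equiv.Perm.sign_mul, Equiv.Perm.sign_swap hne]
      push_cast
      ring
    · intro π _ _ h
      have : Equiv.swap p q = 1 := by
        have := congr_arg (· * π⁻¹) h
        simpa using this
      exact absurd (Equiv.swap_eq_one_iff.mp this) hne
    · intro π hπ
      simp only [mem_filter, mem_univ, true_and] at hπ ⊢
      have hswap : u ∘ ⇑(Equiv.swap p q) = u := by
        funext x
        simp only [Function.comp_apply]
        rcases eq_or_ne x p with rfl | hxp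
        · rw [Equiv.swap_apply_left]; exact hpq.symm
        · rcases eq_or_ne x q with rfl | hxq
          · rw [Equiv.swap_apply_right]; exact hpq
          · rw [Equiv.swap_apply_of_ne_of_ne hxp hxq]
      calc u ∘ ⇑(Equiv.swap p q * π) = (u ∘ ⇑(Equiv.swap p q)) ∘ ⇑π := rfl
        _ = u := by rw [hswap, hπ]
    · intro π _
      simp [← mul_assoc]

/-- The injective words `ι → α`, grouped by their image: `∑_{u injective} ∏_q z_{u q} =
|ι|! · ∑_{|S| = |ι|} ∏_{a ∈ S} z_a` (`= |ι|! e_{|ι|}(z)`). [folklore] -/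
private theorem sum_injective_prod_eq {ι α : Type*} [Fintype ι] [DecidableEq ι] [Fintype α] [DecidableEq α]
    {R : Type*} [CommRing R] (z : α → R) :
    ∑ u ∈ univ.filter (fun u : ι → α => Function.Injective u), ∏ q, z (u q) =
      (Fintype.card ι).factorial • ∑ S ∈ powersetCard (Fintype.card ι) (univ : Finset α), ∏ a ∈ S, z a := by
  classical
  -- the image of an injective word
  have himg : ∀ u ∈ univ.filter (fun u : ι → α => Function.Injective u),
      univ.image u ∈ powersetCard (Fintype.card ι) (univ : Finset α) := by
    intro u hu
    rw [mem_filter] at hu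
    rw [mem_powersetCard]
    exact ⟨subset_univ _, by rw [Finset.card_image_of_injective _ hu.2, Finset.card_univ]⟩
  rw [← Finset.sum_fiberwise_of_maps_to himg, Finset.smul_sum]
  refine Finset.sum_congr rfl fun S hS => ?_
  rw [mem_powersetCard] at hS
  -- on the fibre of `S` the product is `∏_{a ∈ S} z_a`
  have hfib : ∀ u ∈ (univ.filter (fun u : ι → α => Function.Injective u)).filter
      (fun u => univ.image u = S), ∏ q, z (u q) = ∏ a ∈ S, z a := by
    intro u hu
    simp only [mem_filter, mem_univ, true_and] at hu
    rw [← hu.2, Finset.prod_image fun x _ y _ h => hu.1 h]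
  rw [Finset.sum_congr rfl hfib, Finset.sum_const]
  congr 1
  -- count the injective words with image `S`: they are the bijections `ι ≃ S`
  have hcardS : Fintype.card S = Fintype.card ι := by rw [Fintype.card_coe, hS.2]
  let e : {u : ι → α // Function.Injective u ∧ univ.image u = S} ≃ (ι ≃ S) :=
    { toFun := fun u => Equiv.ofBijective (fun q => ⟨u.1 q, by
          have h : u.1 q ∈ univ.image u.1 := mem_image_of_mem u.1 (mem_univ q)
          rwa [u.2.2] at h⟩) (by
          rw [Fintype.bijective_iff_injective_and_card, hcardS]
          exact ⟨fun a b h => u.2.1 (congr_arg Subtype.val h), rfl⟩)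
      invFun := fun f => ⟨fun q => (f q).1, fun a b h => f.injective (Subtype.ext h), by
          ext a
          simp only [mem_image, mem_univ, true_and]
          constructor
          · rintro ⟨q, rfl⟩; exact (f q).2
          · intro ha; exact ⟨f.symm ⟨a, ha⟩, by simp⟩⟩
      left_inv := fun u => by ext q; rfl
      right_inv := fun f => by ext q; rfl }
  have h := Fintype.card_congr e
  rw [Fintype.card_equiv (Fintype.equivOfCardEq hcardS.symm)] at h
  rw [← h, Fintype.card_subtype]
  congr 1
  ext u
  simp only [mem_filter, mem_univ, true_and]

/-- **Signed Burnside / the cycle-index identity for `e`**: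
`∑_{π ∈ 𝔖_ι} sign(π) ∑_{u ∘ π = u} ∏_q z_{u q} = |ι|! · ∑_{|S| = |ι|} ∏_{a ∈ S} z_a`, i.e.
`∑_π sign(π) p_{ρ(π)}(z) = |ι|! · e_{|ι|}(z)` (Macdonald I (2.14'): `e_n = ∑_{|ρ|=n} ε_ρ z_ρ⁻¹ p_ρ`):
exchanging the sums leaves `∑_u (∑_{π ∈ Stab u} sign π) z^u`, and the inner sum selects the injective
words. [cite: Macdonald1995, Ch. I §2 (2.14')] -/
theorem sum_sign_mul_sum_fixed_prod_eq {ι α : Type*} [Fintype ι] [DecidableEq ι] [Fintype α]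
    [DecidableEq α] {R : Type*} [CommRing R] (z : α → R) :
    ∑ π : Perm ι, ((Equiv.Perm.sign π : ℤ) : R) *
        ∑ u ∈ univ.filter (fun u : ι → α => u ∘ ⇑π = u), ∏ q, z (u q) =
      (Fintype.card ι).factorial •
        ∑ S ∈ powersetCard (Fintype.card ι) (univ : Finset α), ∏ a ∈ S, z a := by
  classical
  have h1 : ∀ π : Perm ι, ((Equiv.Perm.sign π : ℤ) : R) *
      ∑ u ∈ univ.filter (fun u : ι → α => u ∘ ⇑π = u), ∏ q, z (u q) =
        ∑ u : ι → α, if u ∘ ⇑π = u then ((Equiv.Perm.sign π : ℤ) : R) * ∏ q, z (u q) else 0 := by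
    intro π
    simp_rw [Finset.sum_filter, Finset.mul_sum, mul_ite, mul_zero]
  simp_rw [h1]
  rw [Finset.sum_comm]
  have h2 : ∀ u : ι → α, ∑ π : Perm ι,
      (if u ∘ ⇑π = u then ((Equiv.Perm.sign π : ℤ) : R) * ∏ q, z (u q) else 0) =
        (if Function.Injective u then 1 else 0) * ∏ q, z (u q) := by
    intro u
    rw [← Finset.sum_filter, ← Finset.sum_mul, sum_stab_sign_eq_ite]
  simp_rw [h2]
  rw [← sum_injective_prod_eq z, Finset.sum_filter]
  exact Finset.sum_congr rfl fun u _ => by split_ifs <;> simp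

/-! ### 2. The stabiliser of a two-letter word, with the sign of the second fibre -/

/-- **Fixed words factor over the fibres of `w`** (general alphabet): for `σ` stabilising the word
`w : [D] → {0,1}`, a word `v : [D] → α` is fixed by `σ` iff its restrictions to the fibres `w⁻¹(i)`
are fixed by the restrictions `σ|_{w⁻¹(i)}`; hence the fixed-word enumerator of `σ` is the product
of those of its two restrictions (`F_σ = ∏_{cycles} p_{|c|}` grouped by fibre; the tree's
`sum_fixed_prod_eq_prod_fibre` is the case of the alphabet `[N]`). [cite: FultonHarrisGTM129, §4.1 (4.10)] -/
theorem sum_fixed_prod_eq_prod_fibre_alphabet {D : ℕ} {α : Type*} [Fintype α] [DecidableEq α]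
    {R : Type*} [CommSemiring R] (z : α → R) (w : Fin D → Fin 2) (σ : Perm (Fin D))
    (hσ : w ∘ ⇑σ = w) :
    ∑ v ∈ univ.filter (fun v : Fin D → α => v ∘ ⇑σ = v), ∏ p, z (v p) =
      ∏ i : Fin 2, ∑ u ∈ univ.filter (fun u : {p // w p = i} → α =>
        u ∘ ⇑(σ.subtypePerm (fun p => by rw [show w (σ p) = w p from congr_fun hσ p])) = u),
        ∏ q, z (u q) := by
  let Θ : (Fin D → α) ≃ ((i : Fin 2) → ({p // w p = i} → α)) :=
    { toFun := fun v i q => v q.1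
      invFun := fun g p => g (w p) ⟨p, rfl⟩
      left_inv := fun v => rfl
      right_inv := fun g => by
        funext i q
        obtain ⟨p, hp⟩ := q
        subst hp
        rfl }
  rw [Finset.prod_univ_sum]
  refine Finset.sum_equiv Θ (fun v => ?_) (fun v hv => ?_)
  · simp only [mem_filter, mem_univ, true_and, Fintype.mem_piFinset]
    constructor
    · intro hv i
      funext q
      simp only [Function.comp_apply, Equiv.Perm.subtypePerm_apply, Θ, Equiv.coe_fn_mk]
      exact congr_fun hv q.1
    · intro h
      funext p
      have := congr_fun (h (w p)) ⟨p, rfl⟩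
      simpa [Θ] using this
  · rw [← Fintype.prod_fiberwise w (fun p => z (v p))]
    rfl

/-- **The signed stabiliser sum**: for a two-letter word `w : [D] → {0,1}` with fibres of sizes
`c₀, c₁` and any alphabet `α` with weights `z`,
`∑_{σ ∈ Stab w} sign(σ|_{w⁻¹(1)}) F_σ(z) = (c₀! c₁!) · h_{c₀}(z) · e_{c₁}(z)`, where
`F_σ(z) = ∑_{u ∘ σ = u} ∏_p z_{u p}`, `h_r(z) = ∑_{|M| = r} z^M` and `e_s(z) = ∑_{|S| = s} ∏_{a ∈ S} z_a`
(`Stab w ≅ 𝔖_{c₀} × 𝔖_{c₁}`, Burnside on the first fibre and signed Burnside on the second).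
[cite: FultonHarrisGTM129, §4.3 (4.33)] -/
theorem sum_stab_sign_mul_fixedEnum {D : ℕ} {α : Type*} [Fintype α] [DecidableEq α]
    {R : Type*} [CommRing R] (z : α → R) (w : Fin D → Fin 2) :
    ∑ σ : {σ : Perm (Fin D) // w ∘ ⇑σ = w},
      ((Equiv.Perm.sign (σ.1.subtypePerm (p := fun p => w p = 1)
          (fun p => by rw [show w (σ.1 p) = w p from congr_fun σ.2 p])) : ℤ) : R) *
        ∑ u ∈ univ.filter (fun u : Fin D → α => u ∘ ⇑σ.1 = u), ∏ p, z (u p) =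
    ((Fintype.card {p // w p = 0}).factorial * (Fintype.card {p // w p = 1}).factorial : ℕ) •
      ((∑ M ∈ piAntidiag (univ : Finset α) (Fintype.card {p // w p = 0}), ∏ a, z a ^ M a) *
        (∑ S ∈ powersetCard (Fintype.card {p // w p = 1}) (univ : Finset α), ∏ a ∈ S, z a)) := by
  -- the fibre enumerators
  let Fz : (i : Fin 2) → Perm {p // w p = i} → R := fun i π =>
    ∑ u ∈ univ.filter (fun u : {p // w p = i} → α => u ∘ ⇑π = u), ∏ q, z (u q)
  -- the equivalence `Stab w ≃ ∏_i Perm(w⁻¹ i)`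
  have hres : ∀ σ : {σ : Perm (Fin D) // w ∘ ⇑σ = w}, ∀ i (p : Fin D), w (σ.1 p) = i ↔ w p = i :=
    fun σ i p => by rw [show w (σ.1 p) = w p from congr_fun σ.2 p]
  let e : {σ : Perm (Fin D) // w ∘ ⇑σ = w} ≃ ((i : Fin 2) → Perm {p // w p = i}) :=
    { toFun := fun σ i => σ.1.subtypePerm (hres σ i)
      invFun := fun g => ⟨DomMulAct.stabilizerEquiv_invFun_aux g,
        funext fun p => DomMulAct.comp_stabilizerEquiv_invFun g p⟩
      left_inv := fun σ => by
        apply Subtype.ext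
        refine Equiv.ext fun p => ?_
        show DomMulAct.stabilizerEquiv_invFun (fun i => σ.1.subtypePerm (hres σ i)) p = σ.1 p
        rw [DomMulAct.stabilizerEquiv_invFun_eq _ rfl]
        rfl
      right_inv := fun g => by
        funext i
        refine Equiv.ext fun q => Subtype.ext ?_
        show DomMulAct.stabilizerEquiv_invFun g q.1 = (g i q).1
        rw [DomMulAct.stabilizerEquiv_invFun_eq g q.2] }
  -- the weights `G i` on the two factors
  let G : (i : Fin 2) → Perm {p // w p = i} → R := fun i =>
    if i = 1 then fun π => ((Equiv.Perm.sign π : ℤ) : R) * Fz i π else fun π => Fz i π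
  -- transport the sum
  have step1 : ∑ σ : {σ : Perm (Fin D) // w ∘ ⇑σ = w},
      ((Equiv.Perm.sign (σ.1.subtypePerm (p := fun p => w p = 1)
          (fun p => by rw [show w (σ.1 p) = w p from congr_fun σ.2 p])) : ℤ) : R) *
        ∑ u ∈ univ.filter (fun u : Fin D → α => u ∘ ⇑σ.1 = u), ∏ p, z (u p) =
      ∑ g : (i : Fin 2) → Perm {p // w p = i}, ∏ i, G i (g i) := by
    refine Fintype.sum_equiv e _ _ fun σ => ?_
    rw [sum_fixed_prod_eq_prod_fibre_alphabet z w σ.1 σ.2, Fin.prod_univ_two, Fin.prod_univ_two]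
    simp only [G, Fz, e, if_neg (show (0 : Fin 2) ≠ 1 by decide), if_pos rfl, Equiv.coe_fn_mk]
    ring
  have step2 : ∑ g : (i : Fin 2) → Perm {p // w p = i}, ∏ i, G i (g i) =
      ∏ i : Fin 2, ∑ π : Perm {p // w p = i}, G i π := by
    rw [Finset.prod_univ_sum (fun _ => univ) (fun i π => G i π), Fintype.piFinset_univ]
  rw [step1, step2, Fin.prod_univ_two]
  simp only [G, Fz, if_neg (show (0 : Fin 2) ≠ 1 by decide), if_pos rfl,
    sum_perm_sum_fixed_prod_eq, sum_sign_mul_sum_fixed_prod_eq, smul_mul_smul_comm]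

/-! ### 3. The signed fixed-subset count `ψ'_k` (the character of `Λ^k` of the permutation
representation) and its stabiliser sums -/

namespace IP17Hook

/-- For a two-letter word `w : [D] → {0,1}` and `σ ∈ 𝔖_D`: the sign of the restriction of `σ` to the
fibre `w⁻¹(1)` if `σ` fixes `w`, and `0` otherwise. Summed over the words with `k` ones this is the
character of `Λ^k ℂ^D` at `σ` (`∑_{|S| = k, σS = S} sign(σ|_S)`). [folklore] -/
def signedFix {D : ℕ} (w : Fin D → Fin 2) (σ : Perm (Fin D)) : ℤ :=
  if h : w ∘ ⇑σ = w then
    (Equiv.Perm.sign (σ.subtypePerm (p := fun p => w p = 1)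
      (fun p => by rw [show w (σ p) = w p from congr_fun h p])) : ℤ)
  else 0

/-- **`ψ'_k(σ) = ∑_{S ⊆ [D], |S| = k, σ(S) = S} sign(σ|_S)`**, the character of the exterior power
`Λ^k ℂ^D` of the permutation representation of `𝔖_D` (the words are required to have `D - k` zeros
and `k` ones). [cite: FultonHarrisGTM129, Exercise 4.6 and §3.2] -/
def signedFixCount (D k : ℕ) (σ : Perm (Fin D)) : ℤ :=
  ∑ w ∈ (univ : Finset (Fin D → Fin 2)).filter (fun w =>
      (univ.filter fun p => w p = 0).card = D - k ∧ (univ.filter fun p => w p = 1).card = k),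
    signedFix w σ

/-- On the stabiliser of `w`, `signedFix w σ` is the sign of `σ|_{w⁻¹(1)}`. [folklore] -/
private theorem signedFix_of_comp_eq {D : ℕ} (w : Fin D → Fin 2) (σ : {σ : Perm (Fin D) // w ∘ ⇑σ = w}) :
    signedFix w σ.1 = (Equiv.Perm.sign (σ.1.subtypePerm (p := fun p => w p = 1)
      (fun p => by rw [show w (σ.1 p) = w p from congr_fun σ.2 p])) : ℤ) := by
  unfold signedFix
  rw [dif_pos σ.2]

/-- `∑_σ signedFix_w(σ) f(σ) = ∑_{σ ∈ Stab w} sign(σ|_{w⁻¹(1)}) f(σ)`. [folklore] -/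
private theorem sum_signedFix_mul {D : ℕ} {R : Type*} [CommRing R] (w : Fin D → Fin 2)
    (f : Perm (Fin D) → R) :
    ∑ σ : Perm (Fin D), (signedFix w σ : R) * f σ =
      ∑ σ : {σ : Perm (Fin D) // w ∘ ⇑σ = w},
        ((Equiv.Perm.sign (σ.1.subtypePerm (p := fun p => w p = 1)
          (fun p => by rw [show w (σ.1 p) = w p from congr_fun σ.2 p])) : ℤ) : R) * f σ.1 := by
  have h1 : ∑ σ : Perm (Fin D), (signedFix w σ : R) * f σ =
      ∑ σ ∈ univ.filter (fun σ : Perm (Fin D) => w ∘ ⇑σ = w), (signedFix w σ : R) * f σ := by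
    rw [Finset.sum_filter]
    refine Finset.sum_congr rfl fun σ _ => ?_
    split_ifs with h
    · rfl
    · rw [signedFix, dif_neg h, Int.cast_zero, zero_mul]
  rw [h1, Finset.sum_subtype (univ.filter fun σ : Perm (Fin D) => w ∘ ⇑σ = w)
    (p := fun σ : Perm (Fin D) => w ∘ ⇑σ = w) (fun σ => by simp)]
  refine Finset.sum_congr rfl fun σ _ => ?_
  rw [signedFix_of_comp_eq w σ]

/-- `ψ'_k` against a function of `σ`: `∑_σ ψ'_k(σ) f(σ) = ∑_{w} ∑_{σ ∈ Stab w} sign(σ|_{w⁻¹(1)}) f(σ)`,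
the outer sum over the words with `D - k` zeros and `k` ones. [folklore] -/
private theorem sum_signedFixCount_mul {D k : ℕ} {R : Type*} [CommRing R] (f : Perm (Fin D) → R) :
    ∑ σ : Perm (Fin D), (signedFixCount D k σ : R) * f σ =
      ∑ w ∈ (univ : Finset (Fin D → Fin 2)).filter (fun w =>
          (univ.filter fun p => w p = 0).card = D - k ∧ (univ.filter fun p => w p = 1).card = k),
        ∑ σ : {σ : Perm (Fin D) // w ∘ ⇑σ = w},
          ((Equiv.Perm.sign (σ.1.subtypePerm (p := fun p => w p = 1)
            (fun p => by rw [show w (σ.1 p) = w p from congr_fun σ.2 p])) : ℤ) : R) * f σ.1 := by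
  simp only [signedFixCount, Int.cast_sum, Finset.sum_mul]
  rw [Finset.sum_comm]
  exact Finset.sum_congr rfl fun w _ => sum_signedFix_mul w f

end IP17Hook

/-! ### 4. The one-row Schur polynomial and the signed Frobenius stabiliser sum -/

/-- `s_{(r)} = h_r`: the Jacobi–Trudi matrix of the one-row weight `(r, 0, …, 0)` is upper
triangular with diagonal `(h_r, 1, …, 1)`. [cite: Macdonald1995, Ch. I (3.4)] -/
theorem schur_oneRow_eq_hsymm {R : Type*} [CommRing R] {n : ℕ} (x : Fin n → R) (r : ℕ)
    (hn : 0 < n) :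
    schur x (fun i : Fin n => if (i : ℕ) = 0 then r else 0) = hsymm x r := by
  unfold schur
  rw [Matrix.det_of_upperTriangular]
  · rw [Finset.prod_eq_single (⟨0, hn⟩ : Fin n)]
    · simp [hsymmZ]
    · intro i _ hi
      have hi' : (i : ℕ) ≠ 0 := fun h => hi (Fin.ext h)
      simp only [Matrix.of_apply, if_neg hi']
      rw [show ((0 : ℕ) : ℤ) - (i : ℕ) + (i : ℕ) = 0 by ring, hsymmZ_zero]
    · intro h; exact absurd (mem_univ _) h
  · intro i j hij
    simp only [id_eq] at hij
    have hi' : (i : ℕ) ≠ 0 := by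
      intro h
      have : (j : ℕ) < i := hij
      omega
    simp only [Matrix.of_apply, if_neg hi']
    exact hsymmZ_of_neg _ (by
      have : (j : ℕ) < i := hij
      push_cast
      omega)

/-- `a_{(r)+ρ} = h_r a_ρ` (bialternant formula for the one-row weight). [cite: Macdonald1995, Ch. I (3.1), (3.4)] -/
theorem alternant_oneRow_add_rho {R : Type*} [CommRing R] {n : ℕ} (x : Fin n → R) (r : ℕ)
    (hn : 0 < n) :
    alternant x ((fun i : Fin n => if (i : ℕ) = 0 then r else 0) + rho n) =
      hsymm x r * alternant x (rho n) := by
  rw [alternant_add_rho, schur_oneRow_eq_hsymm x r hn]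

/-- **The signed Frobenius stabiliser sum.** For a two-letter word `w : [D] → {0,1}` with fibres of
sizes `c₀, c₁`, `D ≥ 1`, and an exponent vector `lam ∈ ℕ^D`:
`∑_{σ ∈ Stab w} sign(σ|_{w⁻¹(1)}) X^{lam}(σ) = (c₀! c₁!) · [x^{lam+ρ}] ∑_{|S| = c₁} a_{(c₀)+ρ+1_S}(X)`,
where `X^{lam}(σ) = [x^{lam+ρ}](a_ρ F_σ)` is Frobenius's coefficient with `D` letters: the
stabiliser sum of `F_σ` is `c₀! c₁! h_{c₀} e_{c₁}` (`sum_stab_sign_mul_fixedEnum`), `a_ρ h_{c₀} =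
a_{(c₀)+ρ}` and the dual Pieri rule `e_{c₁} a_μ = ∑_{|S|=c₁} a_{μ+1_S}` (`esymm_mul_alternant`).
[cite: FultonHarrisGTM129, §4.3 (4.33) and (4.41)] -/
theorem sum_stab_sign_mul_frobeniusChar {D : ℕ} (hD : 0 < D) (lam : Fin D → ℕ) (w : Fin D → Fin 2) :
    ∑ σ : {σ : Perm (Fin D) // w ∘ ⇑σ = w},
      (Equiv.Perm.sign (σ.1.subtypePerm (p := fun p => w p = 1)
          (fun p => by rw [show w (σ.1 p) = w p from congr_fun σ.2 p])) : ℤ) *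
        frobeniusChar D lam σ.1 =
    ((Fintype.card {p // w p = 0}).factorial * (Fintype.card {p // w p = 1}).factorial : ℕ) *
      coeff (Finsupp.equivFunOnFinite.symm (lam + rho D))
        (∑ S ∈ powersetCard (Fintype.card {p // w p = 1}) univ,
          alternant (fun i => (X i : MvPolynomial (Fin D) ℤ))
            (addOn S ((fun i : Fin D => if (i : ℕ) = 0 then Fintype.card {p // w p = 0} else 0) +
              rho D))) := by
  set c₀ := Fintype.card {p // w p = 0} with hc₀
  set c₁ := Fintype.card {p // w p = 1} with hc₁
  set aρ := alternant (fun i => (X i : MvPolynomial (Fin D) ℤ)) (rho D) with haρ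
  -- each term as a coefficient
  have hterm : ∀ σ : {σ : Perm (Fin D) // w ∘ ⇑σ = w},
      (Equiv.Perm.sign (σ.1.subtypePerm (p := fun p => w p = 1)
          (fun p => by rw [show w (σ.1 p) = w p from congr_fun σ.2 p])) : ℤ) *
        frobeniusChar D lam σ.1 =
      coeff (Finsupp.equivFunOnFinite.symm (lam + rho D))
        (aρ * (((Equiv.Perm.sign (σ.1.subtypePerm (p := fun p => w p = 1)
          (fun p => by rw [show w (σ.1 p) = w p from congr_fun σ.2 p])) : ℤ) : MvPolynomial (Fin D) ℤ) *
          ∑ u ∈ univ.filter (fun u : Fin D → Fin D => u ∘ ⇑σ.1 = u),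
            ∏ p, (X (u p) : MvPolynomial (Fin D) ℤ))) := by
    intro σ
    rw [frobeniusChar_def, haρ]
    have hC : (((Equiv.Perm.sign (σ.1.subtypePerm (p := fun p => w p = 1)
          (fun p => by rw [show w (σ.1 p) = w p from congr_fun σ.2 p])) : ℤ) : MvPolynomial (Fin D) ℤ)) =
        C (Equiv.Perm.sign (σ.1.subtypePerm (p := fun p => w p = 1)
          (fun p => by rw [show w (σ.1 p) = w p from congr_fun σ.2 p])) : ℤ) := by simp
    rw [hC, mul_left_comm, coeff_C_mul]
    rfl
  rw [Fintype.sum_congr _ _ hterm, ← coeff_sum, ← Finset.mul_sum,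
    sum_stab_sign_mul_fixedEnum (fun i => (X i : MvPolynomial (Fin D) ℤ)) w, ← hc₀, ← hc₁]
  -- identify `h_{c₀}` and `e_{c₁}`
  have hh : ∑ M ∈ piAntidiag (univ : Finset (Fin D)) c₀,
      ∏ a, (X a : MvPolynomial (Fin D) ℤ) ^ M a = hsymm (fun i => (X i : MvPolynomial (Fin D) ℤ)) c₀ :=
    (hsymm_eq_sum_piAntidiag _ c₀).symm
  have he : ∑ S ∈ powersetCard c₁ (univ : Finset (Fin D)), ∏ a ∈ S, (X a : MvPolynomial (Fin D) ℤ) =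
      esymm (fun i => (X i : MvPolynomial (Fin D) ℤ)) c₁ := rfl
  rw [hh, he, nsmul_eq_mul]
  have hrew : aρ * (((c₀.factorial * c₁.factorial : ℕ) : MvPolynomial (Fin D) ℤ) *
      (hsymm (fun i => (X i : MvPolynomial (Fin D) ℤ)) c₀ *
        esymm (fun i => (X i : MvPolynomial (Fin D) ℤ)) c₁)) =
      C ((c₀.factorial * c₁.factorial : ℕ) : ℤ) *
        (esymm (fun i => (X i : MvPolynomial (Fin D) ℤ)) c₁ *
          (hsymm (fun i => (X i : MvPolynomial (Fin D) ℤ)) c₀ * aρ)) := by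
    rw [map_natCast]; ring
  rw [hrew, coeff_C_mul, haρ, ← alternant_oneRow_add_rho _ c₀ hD, esymm_mul_alternant]

/-! ### 5. Only the two hooks survive: `e_k · a_{(D-k)+ρ} = a_{hook_k + ρ} + a_{hook_{k-1} + ρ}` -/

namespace IP17Hook

/-- The padded parts vector of the hook `(D - j, 1^j)` in `D` letters: `(D - j, 1, …, 1, 0, …, 0)`
(`j` ones). [cite: IkenmeyerPanova2017, Prop. 6.4 (the hooks (nd-k, 1^k))] -/
def hookVec (D j : ℕ) : Fin D → ℕ :=
  fun i => if (i : ℕ) = 0 then D - j else if (i : ℕ) ≤ j then 1 else 0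

/-- The hook vector is weakly decreasing as soon as `D - j ≥ 1`. [folklore] -/
private theorem hookVec_antitone {D j : ℕ} (hj : j + 1 ≤ D) : Antitone (hookVec D j) := by
  intro a b hab
  have hab' : (a : ℕ) ≤ b := hab
  simp only [hookVec]
  split_ifs <;> omega

/-- Sorting a constant multiset. [folklore] -/
private theorem sort_replicate (n y : ℕ) :
    (Multiset.replicate n y).sort (· ≥ ·) = List.replicate n y := by
  induction n with
  | zero => simp
  | succ n ih =>
    rw [Multiset.replicate_succ, Multiset.sort_cons, ih, List.replicate_succ]
    intro b hb
    rw [Multiset.eq_of_mem_replicate hb]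

/-- **The rows of the hook** `(D - j, 1^j)`: its padded parts vector in `D` letters is `hookVec D j`.
[cite: IkenmeyerPanova2017, Prop. 6.4 (the hooks (nd-k, 1^k))] -/
theorem getD_sortedParts_hook {D j : ℕ} (hj : j + 1 ≤ D) {lam : Nat.Partition D}
    (hlam : lam.parts = (D - j) ::ₘ Multiset.replicate j 1) (i : Fin D) :
    lam.sortedParts.getD (i : ℕ) 0 = hookVec D j i := by
  have hs : lam.sortedParts = (D - j) :: List.replicate j 1 := by
    unfold Nat.Partition.sortedParts
    rw [hlam, Multiset.sort_cons, sort_replicate]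
    intro b hb
    rw [Multiset.eq_of_mem_replicate hb]
    show 1 ≤ D - j
    omega
  rw [hs, hookVec]
  rcases Nat.eq_zero_or_pos (i : ℕ) with h0 | hpos
  · rw [h0]; simp
  · obtain ⟨r, hr⟩ : ∃ r, (i : ℕ) = r + 1 := ⟨(i : ℕ) - 1, by omega⟩
    rw [hr, List.getD_cons_succ, List.getD_eq_getElem?_getD, List.getElem?_replicate,
      if_neg (Nat.succ_ne_zero r)]
    by_cases hrj : r < j
    · rw [if_pos hrj, if_pos (by omega)]; rfl
    · rw [if_neg hrj, if_neg (by omega)]; rfl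

/-- A partition of `D` has at most `D` parts. [folklore] -/
private theorem card_parts_le {D : ℕ} (μ : Nat.Partition D) : μ.parts.card ≤ D := by
  have h := Multiset.card_nsmul_le_sum (s := μ.parts) (a := 1) fun x hx => μ.parts_pos hx
  rw [μ.parts_sum, smul_eq_mul, mul_one] at h
  exact h

/-- A bounded version of the adjacent-gap lemma: if `a ∉ S`, `b ∈ S`, `a < b`, then some `m ≥ a`
has `m ∉ S ∋ m + 1`. [folklore] -/
private theorem exists_adjacent_not_mem_mem_ge {n : ℕ} (S : Finset (Fin n)) :
    ∀ (d : ℕ) (a b : Fin n), (b : ℕ) = a + d + 1 → a ∉ S → b ∈ S →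
      ∃ m : Fin n, ∃ hm : (m : ℕ) + 1 < n, (a : ℕ) ≤ m ∧ m ∉ S ∧ (⟨(m : ℕ) + 1, hm⟩ : Fin n) ∈ S
  | 0, a, b, hd, ha, hb => by
    have hb' := b.is_lt
    have heq : b = ⟨(a : ℕ) + 1, by omega⟩ := Fin.ext (by rw [Fin.val_mk]; omega)
    rw [heq] at hb
    exact ⟨a, by omega, le_rfl, ha, hb⟩
  | d + 1, a, b, hd, ha, hb => by
    have hb' := b.is_lt
    set a' : Fin n := ⟨(a : ℕ) + 1, by omega⟩ with ha'
    by_cases h : a' ∈ S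
    · exact ⟨a, by omega, le_rfl, ha, h⟩
    · obtain ⟨m, hm, ham, h1, h2⟩ :=
        exists_adjacent_not_mem_mem_ge S d a' b (by rw [ha']; simp; omega) h hb
      exact ⟨m, hm, by rw [ha'] at ham; simp at ham; omega, h1, h2⟩

/-- A vertical strip `1_S` added to `(c) + ρ` with an adjacent gap `m ∉ S ∋ m + 1` away from the
first row (`m ≥ 1`) produces two equal exponents, so the alternant vanishes. [folklore] -/
private theorem alternant_addOn_oneRow_rho_eq_zero {D : ℕ} (c : ℕ) {S : Finset (Fin D)} {m : Fin D}
    (hm : (m : ℕ) + 1 < D) (hm1 : 1 ≤ (m : ℕ)) (h1 : m ∉ S) (h2 : (⟨(m : ℕ) + 1, hm⟩ : Fin D) ∈ S) :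
    alternant (fun i => (X i : MvPolynomial (Fin D) ℤ))
      (addOn S ((fun i : Fin D => if (i : ℕ) = 0 then c else 0) + rho D)) = 0 := by
  refine alternant_eq_zero_of_apply_eq _ (i := m) (j := ⟨(m : ℕ) + 1, hm⟩) ?_ ?_
  · intro h
    have := congrArg Fin.val h
    simp at this
  · simp only [addOn_apply, Pi.add_apply, rho_apply, if_neg h1, if_pos h2,
      if_neg (show (m : ℕ) ≠ 0 by omega), if_neg (show (m : ℕ) + 1 ≠ 0 by omega)]
    omega

/-- **Only the two hooks survive.** For `1 ≤ k ≤ D - 1` and an antitone `μ ∈ ℕ^D`: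
`[x^{μ+ρ}] ∑_{|S| = k} a_{(D-k)+ρ+1_S}(X) = [μ = hook_k] + [μ = hook_{k-1}]` — of the vertical
`k`-strips added to the one-row shape `(D-k)`, exactly `S = [1, k]` (giving `(D-k, 1^k)`) and
`S = [0, k)` (giving `(D-k+1, 1^{k-1})`) have distinct exponents: the Pieri rule
`h_{D-k} e_k = s_{(D-k,1^k)} + s_{(D-k+1,1^{k-1})}`. [cite: Macdonald1995, Ch. I §5 (5.16) (Pieri's formula)] -/
theorem coeff_sum_alternant_addOn_oneRow {D k : ℕ} (hk1 : 1 ≤ k) (hkD : k + 1 ≤ D)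
    {mu : Fin D → ℕ} (hmu : Antitone mu) :
    coeff (Finsupp.equivFunOnFinite.symm (mu + rho D))
        (∑ S ∈ powersetCard k (univ : Finset (Fin D)),
          alternant (fun i => (X i : MvPolynomial (Fin D) ℤ))
            (addOn S ((fun i : Fin D => if (i : ℕ) = 0 then D - k else 0) + rho D))) =
      (if mu = hookVec D k then 1 else 0) + (if mu = hookVec D (k - 1) then 1 else 0) := by
  have hD : 0 < D := by omega
  set ν : Fin D → ℕ := (fun i : Fin D => if (i : ℕ) = 0 then D - k else 0) + rho D with hν
  set S₀ : Finset (Fin D) := univ.filter fun i : Fin D => (i : ℕ) < k with hS₀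
  set S₁ : Finset (Fin D) := (univ.filter fun i : Fin D => (i : ℕ) < k + 1).erase ⟨0, hD⟩ with hS₁
  have hS₀card : S₀.card = k := card_filter_lt_of_le (by omega)
  have hmem0 : (⟨0, hD⟩ : Fin D) ∈ (univ.filter fun i : Fin D => (i : ℕ) < k + 1) := by simp
  have hS₁card : S₁.card = k := by
    rw [hS₁, Finset.card_erase_of_mem hmem0, card_filter_lt_of_le hkD]
    rfl
  have hmemS₀ : ∀ i : Fin D, i ∈ S₀ ↔ (i : ℕ) < k := fun i => by simp [hS₀]
  have hmemS₁ : ∀ i : Fin D, i ∈ S₁ ↔ 1 ≤ (i : ℕ) ∧ (i : ℕ) ≤ k := fun i => by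
    simp only [hS₁, Finset.mem_erase, mem_filter, mem_univ, true_and, ne_eq, Fin.ext_iff]
    omega
  have hne : S₁ ≠ S₀ := by
    intro h
    have : (⟨0, hD⟩ : Fin D) ∈ S₁ := by rw [h, hmemS₀]; exact hk1
    rw [hmemS₁] at this
    simp at this
  have hS₀mem : S₀ ∈ powersetCard k (univ : Finset (Fin D)) :=
    mem_powersetCard.mpr ⟨subset_univ _, hS₀card⟩
  have hS₁mem : S₁ ∈ (powersetCard k (univ : Finset (Fin D))).erase S₀ :=
    Finset.mem_erase.mpr ⟨hne, mem_powersetCard.mpr ⟨subset_univ _, hS₁card⟩⟩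
  -- the two surviving strips
  have hadd₀ : addOn S₀ ν = hookVec D (k - 1) + rho D := by
    funext i
    simp only [addOn_apply, hν, Pi.add_apply, rho_apply, hookVec, hmemS₀]
    split_ifs <;> omega
  have hadd₁ : addOn S₁ ν = hookVec D k + rho D := by
    funext i
    simp only [addOn_apply, hν, Pi.add_apply, rho_apply, hookVec, hmemS₁]
    split_ifs <;> omega
  -- all other strips vanish
  have hrest : ∀ S ∈ ((powersetCard k (univ : Finset (Fin D))).erase S₀).erase S₁,
      alternant (fun i => (X i : MvPolynomial (Fin D) ℤ)) (addOn S ν) = 0 := by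
    intro S hS
    rw [Finset.mem_erase, Finset.mem_erase, mem_powersetCard] at hS
    obtain ⟨hS1, hS0, -, hcard⟩ := hS
    by_cases h0 : (⟨0, hD⟩ : Fin D) ∈ S
    · -- compare with `S₀`
      have h1 : ¬ S ⊆ S₀ := fun h =>
        hS0 (Finset.eq_of_subset_of_card_le h (by rw [hS₀card, hcard]))
      have h2 : ¬ S₀ ⊆ S := fun h =>
        hS0 (Finset.eq_of_subset_of_card_le h (by rw [hS₀card, hcard])).symm
      rw [Finset.not_subset] at h1 h2
      obtain ⟨b, hbS, hb⟩ := h1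
      obtain ⟨a, ha, haS⟩ := h2
      rw [hmemS₀] at ha hb
      have ha1 : 1 ≤ (a : ℕ) := by
        by_contra h
        apply haS
        have : a = ⟨0, hD⟩ := Fin.ext (by simp; omega)
        rw [this]; exact h0
      obtain ⟨m, hm, ham, hm1, hm2⟩ :=
        exists_adjacent_not_mem_mem_ge S ((b : ℕ) - a - 1) a b (by omega) haS hbS
      exact alternant_addOn_oneRow_rho_eq_zero (D - k) hm (le_trans ha1 ham) hm1 hm2
    · -- compare with `S₁`
      have h1 : ¬ S ⊆ S₁ := fun h =>
        hS1 (Finset.eq_of_subset_of_card_le h (by rw [hS₁card, hcard]))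
      have h2 : ¬ S₁ ⊆ S := fun h =>
        hS1 (Finset.eq_of_subset_of_card_le h (by rw [hS₁card, hcard])).symm
      rw [Finset.not_subset] at h1 h2
      obtain ⟨b, hbS, hb⟩ := h1
      obtain ⟨a, ha, haS⟩ := h2
      rw [hmemS₁] at ha hb
      have hb0 : (b : ℕ) ≠ 0 := by
        intro h
        apply h0
        have : b = ⟨0, hD⟩ := Fin.ext h
        rw [← this]; exact hbS
      obtain ⟨m, hm, ham, hm1, hm2⟩ :=
        exists_adjacent_not_mem_mem_ge S ((b : ℕ) - a - 1) a b (by omega) haS hbS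
      exact alternant_addOn_oneRow_rho_eq_zero (D - k) hm (le_trans ha.1 ham) hm1 hm2
  rw [← Finset.add_sum_erase _ _ hS₀mem, ← Finset.add_sum_erase _ _ hS₁mem,
    Finset.sum_eq_zero hrest, add_zero, coeff_add, hadd₀, hadd₁,
    coeff_add_rho_alternant_X_add_rho hmu (hookVec_antitone (by omega)),
    coeff_add_rho_alternant_X_add_rho hmu (hookVec_antitone hkD), add_comm]

/-! ### 6. `ψ'_k` is a class function and `⟨ψ'_k, χ^μ⟩ = [μ = hook_k] + [μ = hook_{k-1}]` -/

/-- `ψ'_k` is a class function: `ψ'_k(τ σ τ⁻¹) = ψ'_k(σ)` (reindex the words by `w ↦ w ∘ τ⁻¹`; the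
restriction of `τ σ τ⁻¹` to `(w ∘ τ⁻¹)⁻¹(1) = τ(w⁻¹(1))` is conjugate to that of `σ`).
[folklore] -/
private theorem signedFixCount_conj (D k : ℕ) (σ τ : Perm (Fin D)) :
    signedFixCount D k (τ * σ * τ⁻¹) = signedFixCount D k σ := by
  unfold signedFixCount
  symm
  have hw : ∀ w : Fin D → Fin 2, (Equiv.arrowCongr τ (Equiv.refl (Fin 2))) w = w ∘ ⇑τ.symm :=
    fun w => by ext p; simp [Equiv.arrowCongr_apply]
  refine Finset.sum_equiv (Equiv.arrowCongr τ (Equiv.refl (Fin 2))) (fun w => ?_) (fun w _ => ?_)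
  · rw [hw]
    simp only [mem_filter, mem_univ, true_and]
    have hc : ∀ a : Fin 2, (univ.filter fun p => (w ∘ ⇑τ.symm) p = a).card =
        (univ.filter fun p => w p = a).card := fun a =>
      Finset.card_equiv τ.symm fun p => by simp
    rw [hc 0, hc 1]
  · rw [hw]
    have hiff : (w ∘ ⇑τ.symm) ∘ ⇑(τ * σ * τ⁻¹) = w ∘ ⇑τ.symm ↔ w ∘ ⇑σ = w := by
      constructor
      · intro h
        funext p
        have := congr_fun h (τ p)
        simpa [Equiv.Perm.mul_apply] using this
      · intro h
        funext p
        have := congr_fun h (τ.symm p)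
        simpa [Equiv.Perm.mul_apply] using this
    unfold signedFix
    by_cases h : w ∘ ⇑σ = w
    · rw [dif_pos h, dif_pos (hiff.mpr h)]
      congr 1
      set e' : {p // w p = 1} ≃ {p // (w ∘ ⇑τ.symm) p = 1} :=
        τ.subtypeEquiv (fun p => by simp) with he'
      rw [← Equiv.Perm.sign_permCongr e']
      congr 1
    · rw [dif_neg h, dif_neg (fun h' => h (hiff.mp h'))]

/-- **`⟨ψ'_k, χ^μ⟩ = [μ = (D-k, 1^k)] + [μ = (D-k+1, 1^{k-1})]`** for `1 ≤ k ≤ D - 1` and every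
`μ ⊢ D` (partitions compared through their padded parts vectors in `D` letters): orbit–stabiliser,
Frobenius's formula for `χ^μ` with `D` letters (`spechtCharacter_eq_frobeniusChar`), the signed
Frobenius stabiliser sum and `coeff_sum_alternant_addOn_oneRow`. This is Pieri's rule
`h_{D-k} e_k = s_{(D-k,1^k)} + s_{(D-k+1,1^{k-1})}` read through Frobenius reciprocity
(`Ind_{𝔖_{D-k} × 𝔖_k}(1 ⊗ sgn) = χ^{(D-k,1^k)} + χ^{(D-k+1,1^{k-1})}`). [cite: FultonHarrisGTM129, Exercise 4.6 and §4.3 (4.41)] -/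
theorem classInner_signedFixCount {D k : ℕ} (hk1 : 1 ≤ k) (hkD : k + 1 ≤ D) (μ : Nat.Partition D) :
    classInner (fun σ => (signedFixCount D k σ : ℂ)) (spechtCharacter ℂ μ) =
      (if (fun i : Fin D => μ.sortedParts.getD (i : ℕ) 0) = hookVec D k then 1 else 0) +
      (if (fun i : Fin D => μ.sortedParts.getD (i : ℕ) 0) = hookVec D (k - 1) then 1 else 0) := by
  have hD : 0 < D := by omega
  set A : ℂ := (if (fun i : Fin D => μ.sortedParts.getD (i : ℕ) 0) = hookVec D k then 1 else 0) +
      (if (fun i : Fin D => μ.sortedParts.getD (i : ℕ) 0) = hookVec D (k - 1) then 1 else 0) with hA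
  set W := (univ : Finset (Fin D → Fin 2)).filter (fun w =>
      (univ.filter fun p => w p = 0).card = D - k ∧ (univ.filter fun p => w p = 1).card = k) with hW
  rw [classInner_apply]
  simp_rw [Literature.RepresentationTheory.FiniteGroups.spechtCharacter_inv]
  rw [sum_signedFixCount_mul (R := ℂ) (spechtCharacter ℂ μ), ← hW]
  -- each stabiliser sum
  have hfib : ∀ w ∈ W, Fintype.card {p // w p = 0} = D - k ∧ Fintype.card {p // w p = 1} = k := by
    intro w hw
    simp only [hW, mem_filter, mem_univ, true_and] at hw
    rw [Fintype.card_subtype, Fintype.card_subtype]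
    exact hw
  have hinner : ∀ w ∈ W, ∑ σ : {σ : Perm (Fin D) // w ∘ ⇑σ = w},
      ((Equiv.Perm.sign (σ.1.subtypePerm (p := fun p => w p = 1)
          (fun p => by rw [show w (σ.1 p) = w p from congr_fun σ.2 p])) : ℤ) : ℂ) *
        spechtCharacter ℂ μ σ.1 =
      ((univ.filter fun σ : Perm (Fin D) => w ∘ ⇑σ = w).card : ℂ) * A := by
    intro w hw
    have hχ : ∀ σ : Perm (Fin D), spechtCharacter ℂ μ σ =
        (frobeniusChar D (fun i : Fin D => μ.sortedParts.getD (i : ℕ) 0) σ : ℂ) := fun σ =>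
      spechtCharacter_eq_frobeniusChar μ (card_parts_le μ) σ
    simp_rw [hχ]
    have h := congr_arg (fun z : ℤ => (z : ℂ))
      (sum_stab_sign_mul_frobeniusChar hD (fun i : Fin D => μ.sortedParts.getD (i : ℕ) 0) w)
    push_cast at h
    rw [h, (hfib w hw).1, (hfib w hw).2,
      coeff_sum_alternant_addOn_oneRow hk1 hkD (getD_sortedParts_antitone (N := D) μ)]
    have hcard : (univ.filter fun σ : Perm (Fin D) => w ∘ ⇑σ = w).card =
        (Fintype.card {p // w p = 0}).factorial * (Fintype.card {p // w p = 1}).factorial := by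
      rw [← Fintype.card_subtype, DomMulAct.stabilizer_card w, Fin.prod_univ_two]
    rw [hcard, (hfib w hw).1, (hfib w hw).2, hA]
    push_cast
    ring
  rw [Finset.sum_congr rfl hinner, ← Finset.sum_mul]
  -- `∑_{w ∈ W} |Stab w| = D!`
  have h := sum_card_stab_eq_factorial_of_content (ι := Fin D) (α := Fin 2) ![D - k, k]
    (by rw [Fin.sum_univ_two, Fintype.card_fin]; simp; omega)
  rw [Fintype.card_fin] at h
  have hsum : ∑ w ∈ W, ((univ.filter fun σ : Perm (Fin D) => w ∘ ⇑σ = w).card : ℂ) =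
      (D.factorial : ℂ) := by
    rw [← Nat.cast_sum, ← h]
    congr 1
    refine Finset.sum_congr ?_ fun _ _ => rfl
    ext w
    simp only [hW, mem_filter, mem_univ, true_and, Fin.forall_fin_two, Matrix.cons_val_zero,
      Matrix.cons_val_one]
  rw [hsum, Fintype.card_perm, Fintype.card_fin, ← mul_assoc,
    inv_mul_cancel₀ (by exact_mod_cast D.factorial_ne_zero), one_mul]

/-- **Pieri's rule for the characters of `𝔖_D`** (the decomposition `Λ^k ℂ^D = Λ^k V ⊕ Λ^{k-1} V`
of the exterior powers of the permutation representation, `V` the standard representation,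
`Λ^j V = S^{(D-j,1^j)}`; Fulton–Harris Exercise 4.6 / Prop. 3.12): for `1 ≤ k ≤ D - 1` and all `σ`,
`χ^{(D-k,1^k)}(σ) + χ^{(D-k+1,1^{k-1})}(σ) = ψ'_k(σ) = ∑_{|S| = k, σS = S} sign(σ|_S)`.
Proof: `ψ'_k` is a class function, hence the sum of its Fourier coefficients against the Specht
characters (`IsClassFun.eq_sum_classInner_smul`, `irrChars_toFinset_perm_eq`), which are computed
in `classInner_signedFixCount`. [cite: FultonHarrisGTM129, Exercise 4.6] -/
theorem spechtCharacter_hook_add_spechtCharacter_hook {D k : ℕ} (hk1 : 1 ≤ k) (hkD : k + 1 ≤ D)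
    (lam lam' : Nat.Partition D) (hlam : lam.parts = (D - k) ::ₘ Multiset.replicate k 1)
    (hlam' : lam'.parts = (D - (k - 1)) ::ₘ Multiset.replicate (k - 1) 1) (σ : Perm (Fin D)) :
    spechtCharacter ℂ lam σ + spechtCharacter ℂ lam' σ = (signedFixCount D k σ : ℂ) := by
  classical
  set f : Perm (Fin D) → ℂ := fun σ => (signedFixCount D k σ : ℂ) with hf
  have hcl : IsClassFun f := fun s t => by
    simp only [hf, signedFixCount_conj]
  have hexp := hcl.eq_sum_classInner_smul
  rw [irrChars_toFinset_perm_eq,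
    Finset.sum_image fun μ _ ν _ h => spechtCharacter_injective h] at hexp
  have hσ := congr_fun hexp σ
  simp only [Finset.sum_apply, Pi.smul_apply, smul_eq_mul] at hσ
  change (signedFixCount D k σ : ℂ) = _ at hσ
  rw [hσ]
  -- identify partitions through their padded parts vectors
  have hvec : ∀ (μ : Nat.Partition D) (j : ℕ) (hj : j + 1 ≤ D) (nu : Nat.Partition D)
      (hnu : nu.parts = (D - j) ::ₘ Multiset.replicate j 1),
      ((fun i : Fin D => μ.sortedParts.getD (i : ℕ) 0) = hookVec D j ↔ μ = nu) := by
    intro μ j hj nu hnu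
    constructor
    · intro h
      apply Weight.ofPartition_injOn_holds D D (card_parts_le μ) (card_parts_le nu)
      funext i
      rw [Weight.ofPartition_apply, Weight.ofPartition_apply, getD_sortedParts_hook hj hnu i,
        ← congr_fun h i]
    · rintro rfl
      funext i
      exact getD_sortedParts_hook hj hnu i
  have hterm : ∀ μ : Nat.Partition D, classInner f (spechtCharacter ℂ μ) * spechtCharacter ℂ μ σ =
      (if μ = lam then spechtCharacter ℂ μ σ else 0) +
        (if μ = lam' then spechtCharacter ℂ μ σ else 0) := by
    intro μ
    rw [hf, classInner_signedFixCount hk1 hkD μ]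
    have h1 : ((fun i : Fin D => μ.sortedParts.getD (i : ℕ) 0) = hookVec D k) ↔ μ = lam :=
      hvec μ k hkD lam hlam
    have h2 : ((fun i : Fin D => μ.sortedParts.getD (i : ℕ) 0) = hookVec D (k - 1)) ↔ μ = lam' :=
      hvec μ (k - 1) (by omega) lam' hlam'
    by_cases hμ1 : μ = lam <;> by_cases hμ2 : μ = lam'
    · rw [if_pos (h1.mpr hμ1), if_pos (h2.mpr hμ2), if_pos hμ1, if_pos hμ2]; ring
    · rw [if_pos (h1.mpr hμ1), if_neg (fun h => hμ2 (h2.mp h)), if_pos hμ1, if_neg hμ2]; ring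
    · rw [if_neg (fun h => hμ1 (h1.mp h)), if_pos (h2.mpr hμ2), if_neg hμ1, if_pos hμ2]; ring
    · rw [if_neg (fun h => hμ1 (h1.mp h)), if_neg (fun h => hμ2 (h2.mp h)), if_neg hμ1,
        if_neg hμ2]; ring
  rw [Finset.sum_congr rfl fun μ _ => hterm μ, Finset.sum_add_distrib, Finset.sum_ite_eq',
    Finset.sum_ite_eq', if_pos (mem_univ _), if_pos (mem_univ _)]

end IP17Hook

/-! ### 7. The master formula `g(R, R', (D-k,1^k)) + g(R, R', (D-k+1,1^{k-1})) = E'(D-k, k)` -/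

/-- **The signed Young-subgroup sum of two rectangular Frobenius coefficients**: for a two-letter
word `w` with fibres of sizes `c₀, c₁`,
`∑_{σ ∈ Stab w} sign(σ|_{w⁻¹(1)}) X^{(aᵇ)}(σ) X^{(cᵈ)}(σ) = |Stab w| · [x^{a𝟙+ρ_b} y^{c𝟙+ρ_d}]
( a_{ρ_b}(x) a_{ρ_d}(y) h_{c₀}(x ⊗ y) e_{c₁}(x ⊗ y) )` in `ℤ[y][x]`, with
`h_r(x ⊗ y) = ∑_{|M|=r} ∏ (x_i y_j)^{M(i,j)}` and `e_s(x ⊗ y) = ∑_{|S| = s} ∏_{(i,j) ∈ S} x_i y_j` — the signed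
twin of `sum_stab_frobeniusChar_mul` (Ikenmeyer–Panova's "`s_μ * (s_{1^k} s_{N-k}) = ∑ c^μ_{αβ}
c^γ_{α'β} s_γ`" paired with `s_λ`, before the Cauchy expansions).
[cite: IkenmeyerPanova2017, proof of Prop. 6.4 (TeX L1386–1398)] -/
theorem sum_stab_sign_mul_frobeniusChar_mul {D b d : ℕ} (a c : ℕ) (w : Fin D → Fin 2) :
    ∑ σ : {σ : Perm (Fin D) // w ∘ ⇑σ = w},
      (Equiv.Perm.sign (σ.1.subtypePerm (p := fun p => w p = 1)
          (fun p => by rw [show w (σ.1 p) = w p from congr_fun σ.2 p])) : ℤ) *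
        (frobeniusChar b (fun _ => a) σ.1 * frobeniusChar d (fun _ => c) σ.1) =
      ((univ.filter fun σ : Perm (Fin D) => w ∘ ⇑σ = w).card : ℤ) *
        coeff (Finsupp.equivFunOnFinite.symm fun j => c + rho d j)
          (coeff (Finsupp.equivFunOnFinite.symm fun j => a + rho b j)
            (alternant (fun i => (X i : MvPolynomial (Fin b) (MvPolynomial (Fin d) ℤ))) (rho b) *
              alternant (fun i => (C (X i) : MvPolynomial (Fin b) (MvPolynomial (Fin d) ℤ))) (rho d) *
              ((∑ M ∈ piAntidiag (univ : Finset (Fin b × Fin d)) (Fintype.card {p // w p = 0}),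
                  ∏ q : Fin b × Fin d,
                    ((X q.1 : MvPolynomial (Fin b) (MvPolynomial (Fin d) ℤ)) * C (X q.2)) ^ M q) *
                (∑ S ∈ powersetCard (Fintype.card {p // w p = 1}) (univ : Finset (Fin b × Fin d)),
                  ∏ q ∈ S, ((X q.1 : MvPolynomial (Fin b) (MvPolynomial (Fin d) ℤ)) * C (X q.2)))))) := by
  set ιx : MvPolynomial (Fin b) ℤ →+* MvPolynomial (Fin b) (MvPolynomial (Fin d) ℤ) :=
    MvPolynomial.map (C : ℤ →+* MvPolynomial (Fin d) ℤ) with hιx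
  set ιy : MvPolynomial (Fin d) ℤ →+* MvPolynomial (Fin b) (MvPolynomial (Fin d) ℤ) :=
    (C : MvPolynomial (Fin d) ℤ →+* MvPolynomial (Fin b) (MvPolynomial (Fin d) ℤ)) with hιy
  set α0 : Fin b →₀ ℕ := Finsupp.equivFunOnFinite.symm fun j => a + rho b j with hα0
  set β0 : Fin d →₀ ℕ := Finsupp.equivFunOnFinite.symm fun j => c + rho d j with hβ0
  -- each term as an iterated coefficient
  have hterm : ∀ σ : {σ : Perm (Fin D) // w ∘ ⇑σ = w},
      (Equiv.Perm.sign (σ.1.subtypePerm (p := fun p => w p = 1)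
          (fun p => by rw [show w (σ.1 p) = w p from congr_fun σ.2 p])) : ℤ) *
        (frobeniusChar b (fun _ => a) σ.1 * frobeniusChar d (fun _ => c) σ.1) =
      coeff β0 (coeff α0 ((((Equiv.Perm.sign (σ.1.subtypePerm (p := fun p => w p = 1)
          (fun p => by rw [show w (σ.1 p) = w p from congr_fun σ.2 p])) : ℤ) :
            MvPolynomial (Fin b) (MvPolynomial (Fin d) ℤ)) *
        (ιx (alternant (fun i => (X i : MvPolynomial (Fin b) ℤ)) (rho b) * fixedWordPoly b σ.1) *
          ιy (alternant (fun i => (X i : MvPolynomial (Fin d) ℤ)) (rho d) * fixedWordPoly d σ.1))))) := by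
    intro σ
    rw [frobeniusChar_def, frobeniusChar_def, hιx, hιy, ← coeff_coeff_map_mul_C']
    have hC : (((Equiv.Perm.sign (σ.1.subtypePerm (p := fun p => w p = 1)
          (fun p => by rw [show w (σ.1 p) = w p from congr_fun σ.2 p])) : ℤ) :
            MvPolynomial (Fin b) (MvPolynomial (Fin d) ℤ))) =
        C (C (Equiv.Perm.sign (σ.1.subtypePerm (p := fun p => w p = 1)
          (fun p => by rw [show w (σ.1 p) = w p from congr_fun σ.2 p])) : ℤ)) := by simp
    rw [hC, coeff_C_mul, coeff_C_mul]
    rfl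
  rw [Fintype.sum_congr _ _ hterm, ← coeff_sum, ← coeff_sum]
  -- pull out the alternants
  have hx : ((ιx : MvPolynomial (Fin b) ℤ →+* MvPolynomial (Fin b) (MvPolynomial (Fin d) ℤ)) ∘
      fun i => (X i : MvPolynomial (Fin b) ℤ)) =
      fun i => (X i : MvPolynomial (Fin b) (MvPolynomial (Fin d) ℤ)) := by
    funext i; simp [hιx]
  have hy : ((ιy : MvPolynomial (Fin d) ℤ →+* MvPolynomial (Fin b) (MvPolynomial (Fin d) ℤ)) ∘
      fun i => (X i : MvPolynomial (Fin d) ℤ)) =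
      fun i => (C (X i) : MvPolynomial (Fin b) (MvPolynomial (Fin d) ℤ)) := by
    funext i; simp [hιy]
  have hsum : ∑ σ : {σ : Perm (Fin D) // w ∘ ⇑σ = w},
      (((Equiv.Perm.sign (σ.1.subtypePerm (p := fun p => w p = 1)
          (fun p => by rw [show w (σ.1 p) = w p from congr_fun σ.2 p])) : ℤ) :
            MvPolynomial (Fin b) (MvPolynomial (Fin d) ℤ)) *
        (ιx (alternant (fun i => (X i : MvPolynomial (Fin b) ℤ)) (rho b) * fixedWordPoly b σ.1) *
          ιy (alternant (fun i => (X i : MvPolynomial (Fin d) ℤ)) (rho d) * fixedWordPoly d σ.1))) =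
      alternant (fun i => (X i : MvPolynomial (Fin b) (MvPolynomial (Fin d) ℤ))) (rho b) *
        alternant (fun i => (C (X i) : MvPolynomial (Fin b) (MvPolynomial (Fin d) ℤ))) (rho d) *
        ∑ σ : {σ : Perm (Fin D) // w ∘ ⇑σ = w},
          (((Equiv.Perm.sign (σ.1.subtypePerm (p := fun p => w p = 1)
            (fun p => by rw [show w (σ.1 p) = w p from congr_fun σ.2 p])) : ℤ) :
              MvPolynomial (Fin b) (MvPolynomial (Fin d) ℤ)) *
          ∑ u ∈ univ.filter (fun u : Fin D → Fin b × Fin d => u ∘ ⇑σ.1 = u),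
            ∏ p, ((X (u p).1 : MvPolynomial (Fin b) (MvPolynomial (Fin d) ℤ)) * C (X (u p).2))) := by
    rw [Finset.mul_sum]
    refine Finset.sum_congr rfl fun σ _ => ?_
    rw [map_mul, map_mul, map_alternant, map_alternant, hx, hy, ringHom_fixedWordPoly,
      ringHom_fixedWordPoly]
    simp only [hιx, hιy, map_X]
    rw [← sum_fixed_mul_sum_fixed' (fun i => (X i : MvPolynomial (Fin b) (MvPolynomial (Fin d) ℤ)))
      (fun i => (C (X i) : MvPolynomial (Fin b) (MvPolynomial (Fin d) ℤ))) σ.1]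
    ring
  rw [hsum, sum_stab_sign_mul_fixedEnum
    (fun q : Fin b × Fin d => (X q.1 : MvPolynomial (Fin b) (MvPolynomial (Fin d) ℤ)) * C (X q.2)) w]
  -- the cardinality of the stabiliser
  have hcard : (univ.filter fun σ : Perm (Fin D) => w ∘ ⇑σ = w).card =
      (Fintype.card {p // w p = 0}).factorial * (Fintype.card {p // w p = 1}).factorial := by
    rw [← Fintype.card_subtype, DomMulAct.stabilizer_card w, Fin.prod_univ_two]
  rw [hcard, nsmul_eq_mul]
  set N : ℕ := (Fintype.card {p // w p = 0}).factorial * (Fintype.card {p // w p = 1}).factorial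
  rw [show ∀ (A B H : MvPolynomial (Fin b) (MvPolynomial (Fin d) ℤ)),
      A * B * ((N : MvPolynomial (Fin b) (MvPolynomial (Fin d) ℤ)) * H) = C (C (N : ℤ)) * (A * B * H) from
      fun A B H => by rw [map_natCast, map_natCast]; ring,
    coeff_C_mul, coeff_C_mul]

/-- The signed Young-subgroup sum of two rectangular characters: for `R, R' ⊢ D` with padded parts
vectors `(aᵇ)`, `(cᵈ)` and a two-letter word `w` with fibres of sizes `c₀, c₁`,
`∑_{σ ∈ Stab w} sign(σ|_{w⁻¹(1)}) χ^R(σ) χ^{R'}(σ) = |Stab w| · [x^{a𝟙+ρ_b} y^{c𝟙+ρ_d}]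
( a_{ρ_b}(x) a_{ρ_d}(y) h_{c₀}(x⊗y) e_{c₁}(x⊗y) )` (Frobenius's formula for both factors, then
`sum_stab_sign_mul_frobeniusChar_mul`). [cite: IkenmeyerPanova2017, proof of Prop. 6.4 (TeX L1386–1398)] -/
theorem sum_stab_sign_mul_spechtCharacter_mul {D b d : ℕ} (a c : ℕ) (R R' : Nat.Partition D)
    (hRb : R.parts.card ≤ b) (hR : ∀ j : Fin b, R.sortedParts.getD j 0 = a)
    (hR'd : R'.parts.card ≤ d) (hR' : ∀ j : Fin d, R'.sortedParts.getD j 0 = c)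
    (w : Fin D → Fin 2) :
    ∑ σ : {σ : Perm (Fin D) // w ∘ ⇑σ = w},
      ((Equiv.Perm.sign (σ.1.subtypePerm (p := fun p => w p = 1)
          (fun p => by rw [show w (σ.1 p) = w p from congr_fun σ.2 p])) : ℤ) : ℂ) *
        (spechtCharacter ℂ R σ.1 * spechtCharacter ℂ R' σ.1) =
      ((univ.filter fun σ : Perm (Fin D) => w ∘ ⇑σ = w).card : ℂ) *
        ((coeff (Finsupp.equivFunOnFinite.symm fun j => c + rho d j)
          (coeff (Finsupp.equivFunOnFinite.symm fun j => a + rho b j)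
            (alternant (fun i => (X i : MvPolynomial (Fin b) (MvPolynomial (Fin d) ℤ))) (rho b) *
              alternant (fun i => (C (X i) : MvPolynomial (Fin b) (MvPolynomial (Fin d) ℤ))) (rho d) *
              ((∑ M ∈ piAntidiag (univ : Finset (Fin b × Fin d)) (Fintype.card {p // w p = 0}),
                  ∏ q : Fin b × Fin d,
                    ((X q.1 : MvPolynomial (Fin b) (MvPolynomial (Fin d) ℤ)) * C (X q.2)) ^ M q) *
                (∑ S ∈ powersetCard (Fintype.card {p // w p = 1}) (univ : Finset (Fin b × Fin d)),
                  ∏ q ∈ S, ((X q.1 : MvPolynomial (Fin b) (MvPolynomial (Fin d) ℤ)) * C (X q.2))))))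
            : ℤ) : ℂ) := by
  have hχR : ∀ σ : Perm (Fin D), spechtCharacter ℂ R σ = (frobeniusChar b (fun _ => a) σ : ℂ) := by
    intro σ
    rw [spechtCharacter_eq_frobeniusChar R hRb σ]
    congr 2
    funext j
    exact hR j
  have hχR' : ∀ σ : Perm (Fin D), spechtCharacter ℂ R' σ = (frobeniusChar d (fun _ => c) σ : ℂ) := by
    intro σ
    rw [spechtCharacter_eq_frobeniusChar R' hR'd σ]
    congr 2
    funext j
    exact hR' j
  simp_rw [hχR, hχR']
  have h := congr_arg (fun z : ℤ => (z : ℂ)) (sum_stab_sign_mul_frobeniusChar_mul (b := b) (d := d) a c w)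
  push_cast at h
  exact h

/-- **The master formula for hooks against two rectangles.** For partitions `R, R' ⊢ D` with padded
parts vectors `(aᵇ)`, `(cᵈ)` (rectangles), `1 ≤ k ≤ D - 1`, and the two hooks
`λ = (D-k, 1^k)`, `λ' = (D-k+1, 1^{k-1})`:
`g(R, R', λ) + g(R, R', λ') = E'(D-k, k)`, where
`E'(r,s) = [x^{a𝟙+ρ_b} y^{c𝟙+ρ_d}] ( a_{ρ_b}(x) a_{ρ_d}(y) h_r(x⊗y) e_s(x⊗y) ) ∈ ℤ`
(`= ∑_{β ⊢ r, α ⊢ s} c^R_{βα} c^{R'}_{βα'}`): the character formula for Kronecker coefficients,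
Pieri's rule for characters (`χ^λ + χ^{λ'} = ψ'_k`), orbit–stabiliser and the signed
Young-subgroup sum — Ikenmeyer–Panova's (6.5)–(6.6)
"`g(ν^k, μ, μ) + g(ν^{k-1}, μ, μ) = ∑ c^μ_{αβ} c^μ_{α'β}`" before the rectangle rule.
[cite: IkenmeyerPanova2017, proof of Prop. 6.4, (6.5)–(6.6) (TeX L1386–1404)] -/
theorem kroneckerCoeff_hook_add_hook_eq {D b d : ℕ} (a c : ℕ) (R R' : Nat.Partition D)
    (hRb : R.parts.card ≤ b) (hR : ∀ j : Fin b, R.sortedParts.getD j 0 = a)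
    (hR'd : R'.parts.card ≤ d) (hR' : ∀ j : Fin d, R'.sortedParts.getD j 0 = c)
    {k : ℕ} (hk1 : 1 ≤ k) (hkD : k + 1 ≤ D) (lam lam' : Nat.Partition D)
    (hlam : lam.parts = (D - k) ::ₘ Multiset.replicate k 1)
    (hlam' : lam'.parts = (D - (k - 1)) ::ₘ Multiset.replicate (k - 1) 1) :
    (kroneckerCoeff ℂ R R' lam : ℤ) + (kroneckerCoeff ℂ R R' lam' : ℤ) =
      coeff (Finsupp.equivFunOnFinite.symm fun j => c + rho d j)
          (coeff (Finsupp.equivFunOnFinite.symm fun j => a + rho b j)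
            (alternant (fun i => (X i : MvPolynomial (Fin b) (MvPolynomial (Fin d) ℤ))) (rho b) *
              alternant (fun i => (C (X i) : MvPolynomial (Fin b) (MvPolynomial (Fin d) ℤ))) (rho d) *
              ((∑ M ∈ piAntidiag (univ : Finset (Fin b × Fin d)) (D - k),
                  ∏ q : Fin b × Fin d,
                    ((X q.1 : MvPolynomial (Fin b) (MvPolynomial (Fin d) ℤ)) * C (X q.2)) ^ M q) *
                (∑ S ∈ powersetCard k (univ : Finset (Fin b × Fin d)),
                  ∏ q ∈ S, ((X q.1 : MvPolynomial (Fin b) (MvPolynomial (Fin d) ℤ)) * C (X q.2)))))) := by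
  set E : ℤ := coeff (Finsupp.equivFunOnFinite.symm fun j => c + rho d j)
          (coeff (Finsupp.equivFunOnFinite.symm fun j => a + rho b j)
            (alternant (fun i => (X i : MvPolynomial (Fin b) (MvPolynomial (Fin d) ℤ))) (rho b) *
              alternant (fun i => (C (X i) : MvPolynomial (Fin b) (MvPolynomial (Fin d) ℤ))) (rho d) *
              ((∑ M ∈ piAntidiag (univ : Finset (Fin b × Fin d)) (D - k),
                  ∏ q : Fin b × Fin d,
                    ((X q.1 : MvPolynomial (Fin b) (MvPolynomial (Fin d) ℤ)) * C (X q.2)) ^ M q) *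
                (∑ S ∈ powersetCard k (univ : Finset (Fin b × Fin d)),
                  ∏ q ∈ S, ((X q.1 : MvPolynomial (Fin b) (MvPolynomial (Fin d) ℤ)) * C (X q.2))))))
    with hE
  set W := (univ : Finset (Fin D → Fin 2)).filter (fun w =>
      (univ.filter fun p => w p = 0).card = D - k ∧ (univ.filter fun p => w p = 1).card = k) with hW
  -- the character formula for both hooks, added
  have key := kroneckerCoeff_eq_sum_spechtCharacter_holds (k := ℂ) R R' lam
  have key' := kroneckerCoeff_eq_sum_spechtCharacter_holds (k := ℂ) R R' lam'
  have hadd : ((D.factorial * kroneckerCoeff ℂ R R' lam : ℕ) : ℂ) +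
      ((D.factorial * kroneckerCoeff ℂ R R' lam' : ℕ) : ℂ) =
      ∑ σ : Perm (Fin D), (IP17Hook.signedFixCount D k σ : ℂ) *
        (spechtCharacter ℂ R σ * spechtCharacter ℂ R' σ) := by
    rw [key, key', ← Finset.sum_add_distrib]
    refine Finset.sum_congr rfl fun σ _ => ?_
    rw [← IP17Hook.spechtCharacter_hook_add_spechtCharacter_hook hk1 hkD lam lam' hlam hlam' σ]
    ring
  rw [IP17Hook.sum_signedFixCount_mul (R := ℂ), ← hW] at hadd
  -- evaluate each stabiliser sum
  have hfib : ∀ w ∈ W, Fintype.card {p // w p = 0} = D - k ∧ Fintype.card {p // w p = 1} = k := by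
    intro w hw
    simp only [hW, mem_filter, mem_univ, true_and] at hw
    rw [Fintype.card_subtype, Fintype.card_subtype]
    exact hw
  have hinner : ∀ w ∈ W, ∑ σ : {σ : Perm (Fin D) // w ∘ ⇑σ = w},
      ((Equiv.Perm.sign (σ.1.subtypePerm (p := fun p => w p = 1)
          (fun p => by rw [show w (σ.1 p) = w p from congr_fun σ.2 p])) : ℤ) : ℂ) *
        (spechtCharacter ℂ R σ.1 * spechtCharacter ℂ R' σ.1) =
      ((univ.filter fun σ : Perm (Fin D) => w ∘ ⇑σ = w).card : ℂ) * (E : ℂ) := by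
    intro w hw
    rw [sum_stab_sign_mul_spechtCharacter_mul a c R R' hRb hR hR'd hR' w, (hfib w hw).1,
      (hfib w hw).2]
  rw [Finset.sum_congr rfl hinner, ← Finset.sum_mul] at hadd
  -- `∑_{w ∈ W} |Stab w| = D!`
  have h := sum_card_stab_eq_factorial_of_content (ι := Fin D) (α := Fin 2) ![D - k, k]
    (by rw [Fin.sum_univ_two, Fintype.card_fin]; simp; omega)
  rw [Fintype.card_fin] at h
  have hsum : ∑ w ∈ W, ((univ.filter fun σ : Perm (Fin D) => w ∘ ⇑σ = w).card : ℂ) =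
      (D.factorial : ℂ) := by
    rw [← Nat.cast_sum, ← h]
    congr 1
    refine Finset.sum_congr ?_ fun _ _ => rfl
    ext w
    simp only [hW, mem_filter, mem_univ, true_and, Fin.forall_fin_two, Matrix.cons_val_zero,
      Matrix.cons_val_one]
  rw [hsum] at hadd
  -- cancel `D!`
  have hadd' : ((D.factorial : ℤ) : ℂ) * (((kroneckerCoeff ℂ R R' lam : ℤ) +
      (kroneckerCoeff ℂ R R' lam' : ℤ) : ℤ) : ℂ) = ((D.factorial : ℤ) : ℂ) * ((E : ℤ) : ℂ) := by
    push_cast at hadd ⊢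
    rw [← hadd]
    ring
  have := mul_left_cancel₀ (by exact_mod_cast D.factorial_ne_zero) hadd'
  exact_mod_cast this

/-! ### 8. Antisymmetric coefficients and the alternant expansion `a_ρ F_π = ∑_γ X^γ(π) a_{γ+ρ}` -/

/-- Permuting the variables multiplies an alternant by the sign: `a_μ(x ∘ σ) = sign(σ) a_μ(x)`
(row permutation of the determinant). [cite: Macdonald1995, Ch. I §3 (a_α is skew-symmetric)] -/
theorem alternant_comp_perm_left {R : Type*} [CommRing R] {n : ℕ} (x : Fin n → R) (μ : Fin n → ℕ)
    (σ : Perm (Fin n)) : alternant (x ∘ ⇑σ) μ = ((Equiv.Perm.sign σ : ℤ) : R) * alternant x μ := by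
  have : (Matrix.of fun i j : Fin n => (x ∘ ⇑σ) i ^ μ j) =
      (Matrix.of fun i j : Fin n => x i ^ μ j).submatrix σ id := rfl
  rw [alternant, this, Matrix.det_permute]
  rfl

/-- The alternant at the generic point is antisymmetric: `rename σ (a_μ(X)) = sign(σ) a_μ(X)`.
[cite: Macdonald1995, Ch. I §3 (a_α is skew-symmetric)] -/
theorem rename_alternant_X {n : ℕ} (μ : Fin n → ℕ) (σ : Perm (Fin n)) :
    rename σ (alternant (fun i => (X i : MvPolynomial (Fin n) ℤ)) μ) =
      ((Equiv.Perm.sign σ : ℤ) : MvPolynomial (Fin n) ℤ) *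
        alternant (fun i => (X i : MvPolynomial (Fin n) ℤ)) μ := by
  have h := map_alternant (rename σ : MvPolynomial (Fin n) ℤ →ₐ[ℤ] MvPolynomial (Fin n) ℤ).toRingHom
    (fun i => (X i : MvPolynomial (Fin n) ℤ)) μ
  rw [AlgHom.toRingHom_eq_coe, RingHom.coe_coe] at h
  rw [h]
  have hx : ((rename σ : MvPolynomial (Fin n) ℤ →ₐ[ℤ] MvPolynomial (Fin n) ℤ) ∘
      fun i => (X i : MvPolynomial (Fin n) ℤ)) = (fun i => (X i : MvPolynomial (Fin n) ℤ)) ∘ ⇑σ := by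
    funext i; simp
  rw [hx, alternant_comp_perm_left]

/-- **Coefficients of an antisymmetric polynomial under permutation of the exponent**: if
`rename σ P = sign(σ) P` for all `σ`, then `[x^{m ∘ σ}] P = sign(σ) [x^m] P`. [cite: Macdonald1995, Ch. I §3 (antisymmetric polynomials)] -/
theorem coeff_comp_perm_of_antisymm {n : ℕ} (P : MvPolynomial (Fin n) ℤ)
    (hP : ∀ σ : Perm (Fin n), rename σ P = ((Equiv.Perm.sign σ : ℤ) : MvPolynomial (Fin n) ℤ) * P)
    (m : Fin n → ℕ) (σ : Perm (Fin n)) :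
    coeff (Finsupp.equivFunOnFinite.symm (m ∘ ⇑σ)) P =
      (Equiv.Perm.sign σ : ℤ) * coeff (Finsupp.equivFunOnFinite.symm m) P := by
  have h := coeff_rename_mapDomain (⇑σ⁻¹) σ⁻¹.injective P (Finsupp.equivFunOnFinite.symm m)
  have hmap : (Finsupp.equivFunOnFinite.symm m).mapDomain (⇑σ⁻¹) =
      Finsupp.equivFunOnFinite.symm (m ∘ ⇑σ) := by
    ext a
    rw [show (⇑σ⁻¹ : Fin n → Fin n) = ⇑(σ⁻¹ : Perm (Fin n)) from rfl, Finsupp.mapDomain_equiv_apply]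
    simp [Equiv.Perm.inv_def]
  rw [hmap, hP σ⁻¹] at h
  have hC : ((Equiv.Perm.sign σ⁻¹ : ℤ) : MvPolynomial (Fin n) ℤ) = C (Equiv.Perm.sign σ⁻¹ : ℤ) := by simp
  rw [hC, coeff_C_mul, Equiv.Perm.sign_inv] at h
  rw [← h, ← mul_assoc, ← Units.val_mul, Int.units_mul_self, Units.val_one, one_mul]

/-- An antisymmetric polynomial over `ℤ` has no monomial with a repeated exponent. [cite: Macdonald1995, Ch. I §3 (a_α = 0 unless the α_i are distinct)] -/
theorem coeff_eq_zero_of_antisymm_of_not_injective {n : ℕ} (P : MvPolynomial (Fin n) ℤ)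
    (hP : ∀ σ : Perm (Fin n), rename σ P = ((Equiv.Perm.sign σ : ℤ) : MvPolynomial (Fin n) ℤ) * P)
    {m : Fin n → ℕ} (hm : ¬ Function.Injective m) :
    coeff (Finsupp.equivFunOnFinite.symm m) P = 0 := by
  simp only [Function.Injective, not_forall, exists_prop] at hm
  obtain ⟨i, j, hij, hne⟩ := hm
  have hfix : m ∘ ⇑(Equiv.swap i j) = m := by
    funext x
    simp only [Function.comp_apply]
    rcases eq_or_ne x i with rfl | hxi
    · rw [Equiv.swap_apply_left]; exact hij.symm
    · rcases eq_or_ne x j with rfl | hxj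
      · rw [Equiv.swap_apply_right]; exact hij
      · rw [Equiv.swap_apply_of_ne_of_ne hxi hxj]
  have h := coeff_comp_perm_of_antisymm P hP m (Equiv.swap i j)
  rw [hfix, Equiv.Perm.sign_swap hne] at h
  simp only [Units.val_neg, Units.val_one, neg_mul, one_mul] at h
  linarith

/-- `a_μ(X) · F_π(X)` is antisymmetric (`F_π` is symmetric, `rename_fixedWordPoly`). [folklore] -/
private theorem rename_alternant_mul_fixedWordPoly {n : ℕ} {ι : Type*} [Fintype ι] [DecidableEq ι]
    (μ : Fin n → ℕ) (π : Perm ι) (σ : Perm (Fin n)) :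
    rename σ (alternant (fun i => (X i : MvPolynomial (Fin n) ℤ)) μ * fixedWordPoly n π) =
      ((Equiv.Perm.sign σ : ℤ) : MvPolynomial (Fin n) ℤ) *
        (alternant (fun i => (X i : MvPolynomial (Fin n) ℤ)) μ * fixedWordPoly n π) := by
  rw [map_mul, rename_alternant_X, rename_fixedWordPoly, mul_assoc]

/-- The degree of an exponent vector given as a function. [folklore] -/
private theorem degree_equivFunOnFinite_symm {n : ℕ} (m : Fin n → ℕ) :
    (Finsupp.equivFunOnFinite.symm m).degree = ∑ i, m i := by
  rw [Finsupp.degree_eq_sum]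
  rfl

/-- `a_μ(X)` is homogeneous of degree `|μ|`. [cite: Macdonald1995, Ch. I §3 (3.1)] -/
theorem isHomogeneous_alternant_X {n : ℕ} (μ : Fin n → ℕ) :
    (alternant (fun i => (X i : MvPolynomial (Fin n) ℤ)) μ).IsHomogeneous (∑ i, μ i) := by
  rw [alternant_X_eq_sum_monomial]
  refine MvPolynomial.IsHomogeneous.sum _ _ _ fun τ _ => ?_
  have hC : ((Equiv.Perm.sign τ : ℤ) : MvPolynomial (Fin n) ℤ) = C (Equiv.Perm.sign τ : ℤ) := by simp
  rw [hC, C_mul_monomial]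
  refine isHomogeneous_monomial _ ?_
  rw [degree_equivFunOnFinite_symm, ← Equiv.sum_comp τ⁻¹ μ]

/-- `F_π(X)` is homogeneous of degree `|ι|`. [cite: FultonHarrisGTM129, §4.1 (4.10)] -/
theorem isHomogeneous_fixedWordPoly {n : ℕ} {ι : Type*} [Fintype ι] [DecidableEq ι] (π : Perm ι) :
    (fixedWordPoly n π).IsHomogeneous (Fintype.card ι) := by
  rw [fixedWordPoly_eq_sum_monomial]
  refine MvPolynomial.IsHomogeneous.sum _ _ _ fun w _ => isHomogeneous_monomial _ ?_
  rw [Finsupp.degree_eq_sum]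
  simp only [wordExps_apply]
  exact sum_card_filter_eq_card w

/-- Frobenius's coefficient `X^γ(π) = [x^{γ+ρ}](a_ρ F_π)` vanishes unless `|γ| = |ι|`
(homogeneity). [folklore] -/
private theorem frobeniusChar_eq_zero_of_sum_ne {n : ℕ} {ι : Type*} [Fintype ι] [DecidableEq ι]
    (γ : Fin n → ℕ) (π : Perm ι) (h : ∑ i, γ i ≠ Fintype.card ι) : frobeniusChar n γ π = 0 := by
  rw [frobeniusChar_def]
  refine ((isHomogeneous_alternant_X (rho n)).mul (isHomogeneous_fixedWordPoly π)).coeff_eq_zero ?_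
  rw [degree_equivFunOnFinite_symm]
  simp only [Pi.add_apply, Finset.sum_add_distrib]
  omega

/-- **The alternant expansion of `a_ρ F_π`** (Frobenius: `a_ρ p_{ρ(π)} = ∑_λ χ^λ(π) a_{λ+ρ}`,
Fulton–Harris (4.10) read as an identity of antisymmetric polynomials; Macdonald I (7.8)): in
`ℤ[X_1, …, X_n]`,
`a_ρ(X) F_π(X) = ∑_{γ ∈ ℕⁿ antitone, |γ| = |ι|} X^γ(π) · a_{γ+ρ}(X)` with `X^γ(π) = [x^{γ+ρ}](a_ρ F_π)`.
Both sides are antisymmetric, so it suffices to compare the coefficients of the sorted monomials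
`x^{λ+ρ}` (`coeff_comp_perm_of_antisymm`, `coeff_eq_zero_of_antisymm_of_not_injective`,
`exists_antitone_add_rho_comp_perm`); off degree `|ι| + |ρ|` both vanish.
[cite: FultonHarrisGTM129, §4.1 (4.10) and Proposition 4.37] -/
theorem alternant_mul_fixedWordPoly_eq_sum {n : ℕ} {ι : Type*} [Fintype ι] [DecidableEq ι]
    (π : Perm ι) :
    alternant (fun i => (X i : MvPolynomial (Fin n) ℤ)) (rho n) * fixedWordPoly n π =
      ∑ γ ∈ antitoneWeights n (Fintype.card ι),
        C (frobeniusChar n γ π) * alternant (fun i => (X i : MvPolynomial (Fin n) ℤ)) (γ + rho n) := by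
  set P := alternant (fun i => (X i : MvPolynomial (Fin n) ℤ)) (rho n) * fixedWordPoly n π with hPdef
  have hP : ∀ σ : Perm (Fin n), rename σ P = ((Equiv.Perm.sign σ : ℤ) : MvPolynomial (Fin n) ℤ) * P :=
    fun σ => rename_alternant_mul_fixedWordPoly (rho n) π σ
  have hA : ∀ (γ : Fin n → ℕ) (σ : Perm (Fin n)),
      rename σ (alternant (fun i => (X i : MvPolynomial (Fin n) ℤ)) (γ + rho n)) =
        ((Equiv.Perm.sign σ : ℤ) : MvPolynomial (Fin n) ℤ) *
          alternant (fun i => (X i : MvPolynomial (Fin n) ℤ)) (γ + rho n) :=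
    fun γ σ => rename_alternant_X _ σ
  apply MvPolynomial.ext
  intro d
  obtain ⟨m, rfl⟩ : ∃ m : Fin n → ℕ, d = Finsupp.equivFunOnFinite.symm m :=
    ⟨d, (Equiv.symm_apply_apply _ _).symm⟩
  rw [coeff_sum]
  simp_rw [coeff_C_mul]
  by_cases hm : Function.Injective m
  · obtain ⟨la, hla, τ, rfl⟩ := exists_antitone_add_rho_comp_perm hm
    rw [coeff_comp_perm_of_antisymm P hP]
    have hterm : ∀ γ ∈ antitoneWeights n (Fintype.card ι),
        frobeniusChar n γ π *
          coeff (Finsupp.equivFunOnFinite.symm ((la + rho n) ∘ ⇑τ))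
            (alternant (fun i => (X i : MvPolynomial (Fin n) ℤ)) (γ + rho n)) =
        if γ = la then (Equiv.Perm.sign τ : ℤ) * frobeniusChar n la π else 0 := by
      intro γ hγ
      rw [coeff_comp_perm_of_antisymm _ (hA γ),
        coeff_add_rho_alternant_X_add_rho hla (mem_antitoneWeights.mp hγ).2]
      by_cases h : γ = la
      · subst h; rw [if_pos rfl, if_pos rfl, mul_one, mul_comm]
      · rw [if_neg (Ne.symm h), if_neg h, mul_zero, mul_zero]
    rw [Finset.sum_congr rfl hterm, Finset.sum_ite_eq']
    by_cases hsum : ∑ i, la i = Fintype.card ι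
    · rw [if_pos (mem_antitoneWeights.mpr ⟨hsum, hla⟩)]
      rfl
    · rw [if_neg (fun h => hsum (mem_antitoneWeights.mp h).1), hPdef, ← frobeniusChar_def,
        frobeniusChar_eq_zero_of_sum_ne la π hsum, mul_zero]
  · rw [coeff_eq_zero_of_antisymm_of_not_injective P hP hm]
    symm
    refine Finset.sum_eq_zero fun γ _ => ?_
    rw [coeff_eq_zero_of_antisymm_of_not_injective _ (hA γ) hm, mul_zero]

/-! ### 9. Conjugate weights and the signed orthogonality `∑_π sign(π) χ^λ(π) χ^μ(π) = s!·[μ = λᵀ]` -/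

namespace IP17Hook

/-- The conjugate (transpose) of a weight `λ ∈ ℕⁿ`, truncated to `n` letters:
`λᵀ_j = #{i < n : λ_i > j}` (faithful when `λ_1 ≤ n`). [cite: Macdonald1995, Ch. I §1 (1.3)] -/
def conjVec (n : ℕ) (la : Fin n → ℕ) : Fin n → ℕ :=
  fun j => (univ.filter fun i : Fin n => (j : ℕ) < la i).card

/-- The conjugate weight is weakly decreasing. [cite: Macdonald1995, Ch. I §1 (1.3)] -/
theorem conjVec_antitone (n : ℕ) (la : Fin n → ℕ) : Antitone (conjVec n la) := by
  intro a b hab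
  have hab' : (a : ℕ) ≤ b := hab
  exact Finset.card_le_card (fun i => by
    simp only [mem_filter, mem_univ, true_and]
    intro h; omega)

/-- `|λᵀ| = |λ|` when `λ_i ≤ n` for all `i` (count the boxes `(i, j)`, `j < λ_i`, by rows and by
columns). [cite: Macdonald1995, Ch. I §1 (1.3)] -/
theorem sum_conjVec {n : ℕ} (la : Fin n → ℕ) (hla : ∀ i, la i ≤ n) :
    ∑ j, conjVec n la j = ∑ i, la i := by
  unfold conjVec
  simp_rw [Finset.card_filter]
  rw [Finset.sum_comm]
  refine Finset.sum_congr rfl fun i _ => ?_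
  rw [← Finset.card_filter]
  exact card_filter_lt_of_le (hla i)

/-- Entries of the conjugate weight are at most `n`. [cite: Macdonald1995, Ch. I §1 (1.3)] -/
theorem conjVec_le (n : ℕ) (la : Fin n → ℕ) (j : Fin n) : conjVec n la j ≤ n :=
  (Finset.card_le_univ _).trans (Fintype.card_fin n).le

/-- The conjugate weight of an antitone weight of size `s` with entries `≤ n` is an antitone weight
of size `s`. [cite: Macdonald1995, Ch. I §1 (1.3)] -/
theorem conjVec_mem_antitoneWeights {n s : ℕ} {la : Fin n → ℕ} (hla : la ∈ antitoneWeights n s)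
    (hle : ∀ i, la i ≤ n) : conjVec n la ∈ antitoneWeights n s := by
  rw [mem_antitoneWeights] at hla ⊢
  exact ⟨by rw [sum_conjVec la hle, hla.1], conjVec_antitone n la⟩

/-- An antitone weight `λ ∈ ℕⁿ` of size `s` is the padded parts vector of a partition of `s` with at
most `n` parts. [folklore] -/
private theorem exists_partition_of_mem_antitoneWeights {n s : ℕ} {la : Fin n → ℕ}
    (hla : la ∈ antitoneWeights n s) :
    ∃ μ : Nat.Partition s, μ.parts.card ≤ n ∧ ∀ i : Fin n, μ.sortedParts.getD (i : ℕ) 0 = la i := by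
  rw [mem_antitoneWeights] at hla
  obtain ⟨hsum, hanti⟩ := hla
  have hχ : Weight.IsPolynomial (fun i => (la i : ℤ) : Weight (Fin n)) :=
    ⟨fun i j hij => Int.ofNat_le.mpr (hanti hij), fun i => Int.natCast_nonneg (la i)⟩
  obtain ⟨μ, ⟨hμn, hμχ⟩, -⟩ := Weight.existsUnique_eq_ofPartition_holds hχ
  have hsize : (Weight.size (fun i => (la i : ℤ) : Weight (Fin n))).toNat = s := by
    simp only [Weight.size]
    rw [← Nat.cast_sum, hsum, Int.toNat_natCast]
  have hget : ∀ i : Fin n, μ.sortedParts.getD (i : ℕ) 0 = la i := fun i => by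
    have := congrFun hμχ i
    rw [Weight.ofPartition_apply] at this
    exact_mod_cast this
  exact ⟨⟨μ.parts, μ.parts_pos, by rw [μ.parts_sum, hsize]⟩, hμn, hget⟩

/-- **The padded parts vector of the transpose**: if `μ ⊢ s` has at most `n` parts and padded parts
vector `λ ∈ ℕⁿ`, then `μᵀ_j = λᵀ_j = #{i < n : λ_i > j}` for `j < n`. [cite: Macdonald1995, Ch. I §1 (1.3)] -/
theorem getD_sortedParts_transpose_eq_conjVec {n s : ℕ} (μ : Nat.Partition s) (hμn : μ.parts.card ≤ n)
    {la : Fin n → ℕ} (hla : ∀ i : Fin n, μ.sortedParts.getD (i : ℕ) 0 = la i) (j : Fin n) :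
    μ.transpose.sortedParts.getD (j : ℕ) 0 = conjVec n la j := by
  set c := μ.transpose.sortedParts.getD (j : ℕ) 0 with hc
  unfold conjVec
  symm
  rw [← Finset.card_range c]
  refine Finset.card_bij (fun (i : Fin n) _ => (i : ℕ)) ?_ ?_ ?_
  · intro i hi
    rw [mem_filter] at hi
    rw [Finset.mem_range, hc, Literature.Computability.Complexity.lt_getD_transpose_iff, hla i]
    exact hi.2
  · intro i _ i' _ h
    exact Fin.ext h
  · intro a ha
    rw [Finset.mem_range, hc, Literature.Computability.Complexity.lt_getD_transpose_iff] at ha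
    have han : a < n := by
      by_contra h
      have hlen : μ.sortedParts.length ≤ a := by
        rw [Nat.Partition.length_sortedParts]; omega
      rw [List.getD_eq_default _ _ hlen] at ha
      exact Nat.not_lt_zero _ ha
    refine ⟨⟨a, han⟩, ?_, rfl⟩
    rw [mem_filter]
    refine ⟨mem_univ _, ?_⟩
    rw [← hla ⟨a, han⟩]
    exact ha

/-- **Signed orthogonality of Frobenius's coefficients**: for antitone weights `λ, μ ∈ ℕⁿ` of size
`s = |ι|`, `∑_{π ∈ 𝔖_ι} sign(π) X^λ(π) X^μ(π) = s!` if `λ_i ≤ n` for all `i` and `μ = λᵀ` (the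
conjugate weight in `n` letters), and `0` otherwise — i.e. `⟨sgn ⊗ χ^λ, χ^μ⟩ = [μ = λᵀ]`
(`χ^{λᵀ} = sgn ⊗ χ^λ`, `spechtCharacter_transpose`, and the orthonormality of the Specht characters);
when `λ_1 > n` the transpose has more than `n` parts and no `μ` qualifies.
[cite: JamesLNM682, 6.6] -/
theorem sum_sign_mul_frobeniusChar_mul_frobeniusChar {n : ℕ} {ι : Type*} [Fintype ι] [DecidableEq ι]
    {la mu : Fin n → ℕ} (hla : la ∈ antitoneWeights n (Fintype.card ι))
    (hmu : mu ∈ antitoneWeights n (Fintype.card ι)) :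
    ∑ π : Perm ι, (Equiv.Perm.sign π : ℤ) * (frobeniusChar n la π * frobeniusChar n mu π) =
      if (∀ i, la i ≤ n) ∧ mu = conjVec n la then ((Fintype.card ι).factorial : ℤ) else 0 := by
  classical
  set s := Fintype.card ι with hs
  -- transport to `𝔖_s`
  let e : ι ≃ Fin s := Fintype.equivFinOfCardEq rfl
  rw [Fintype.sum_equiv (Equiv.permCongr e)
    (fun π : Perm ι => (Equiv.Perm.sign π : ℤ) * (frobeniusChar n la π * frobeniusChar n mu π))
    (fun π : Perm (Fin s) => (Equiv.Perm.sign π : ℤ) * (frobeniusChar n la π * frobeniusChar n mu π))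
    (fun π => by rw [Equiv.Perm.sign_permCongr, frobeniusChar_permCongr, frobeniusChar_permCongr])]
  -- the partitions
  obtain ⟨μ₁, hμ₁n, hμ₁⟩ := exists_partition_of_mem_antitoneWeights hla
  obtain ⟨μ₂, hμ₂n, hμ₂⟩ := exists_partition_of_mem_antitoneWeights hmu
  have hla' : (fun i : Fin n => μ₁.sortedParts.getD (i : ℕ) 0) = la := funext hμ₁
  have hmu' : (fun i : Fin n => μ₂.sortedParts.getD (i : ℕ) 0) = mu := funext hμ₂
  -- the sum in `ℂ`, through the Specht characters
  have hC : ((∑ π : Perm (Fin s), (Equiv.Perm.sign π : ℤ) *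
      (frobeniusChar n la π * frobeniusChar n mu π) : ℤ) : ℂ) =
      (s.factorial : ℂ) * classInner (spechtCharacter ℂ μ₁.transpose) (spechtCharacter ℂ μ₂) := by
    rw [classInner_apply, Fintype.card_perm, Fintype.card_fin, ← mul_assoc,
      mul_inv_cancel₀ (by exact_mod_cast s.factorial_ne_zero), one_mul]
    push_cast
    refine Finset.sum_congr rfl fun π _ => ?_
    rw [Literature.RepresentationTheory.FiniteGroups.spechtCharacter_inv, spechtCharacter_transpose,
      spechtCharacter_eq_frobeniusChar μ₁ hμ₁n π, spechtCharacter_eq_frobeniusChar μ₂ hμ₂n π, hla', hmu']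
    ring
  have horth := (isIrrChar_spechtCharacter μ₁.transpose).classInner_eq (isIrrChar_spechtCharacter μ₂)
  -- `μ₁ᵀ = μ₂ ↔ λ ≤ n ∧ μ = λᵀ`
  have hcardT : μ₁.transpose.parts.card = μ₁.sortedParts.getD 0 0 :=
    Literature.Computability.Complexity.card_parts_transpose_eq μ₁
  have hiff : μ₁.transpose = μ₂ ↔ (∀ i, la i ≤ n) ∧ mu = conjVec n la := by
    constructor
    · intro h
      have hTn : μ₁.transpose.parts.card ≤ n := by rw [h]; exact hμ₂n
      refine ⟨fun i => ?_, funext fun j => ?_⟩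
      · have h0 : la i ≤ la ⟨0, Fin.pos i⟩ :=
          (mem_antitoneWeights.mp hla).2 (Fin.le_def.mpr (Nat.zero_le _))
        rw [← hμ₁ ⟨0, Fin.pos i⟩] at h0
        exact h0.trans (hcardT ▸ hTn)
      · rw [← hμ₂ j, ← h, getD_sortedParts_transpose_eq_conjVec μ₁ hμ₁n hμ₁ j]
    · rintro ⟨hle, hmueq⟩
      have hTn : μ₁.transpose.parts.card ≤ n := by
        rw [hcardT]
        rcases Nat.eq_zero_or_pos n with hn | hn
        · subst hn
          have : μ₁.sortedParts.length ≤ 0 := by rw [Nat.Partition.length_sortedParts]; exact hμ₁n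
          rw [List.getD_eq_default _ _ (by omega)]
        · rw [hμ₁ ⟨0, hn⟩]; exact hle _
      apply Weight.ofPartition_injOn_holds n s hTn hμ₂n
      funext j
      rw [Weight.ofPartition_apply, Weight.ofPartition_apply,
        getD_sortedParts_transpose_eq_conjVec μ₁ hμ₁n hμ₁ j, hμ₂ j, hmueq]
  by_cases hcond : (∀ i, la i ≤ n) ∧ mu = conjVec n la
  · rw [if_pos hcond]
    have h1 : classInner (spechtCharacter ℂ μ₁.transpose) (spechtCharacter ℂ μ₂) = 1 := by
      rw [horth, if_pos (by rw [hiff.mpr hcond])]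
    rw [h1, mul_one] at hC
    exact_mod_cast hC
  · rw [if_neg hcond]
    have h0 : classInner (spechtCharacter ℂ μ₁.transpose) (spechtCharacter ℂ μ₂) = 0 := by
      rw [horth, if_neg (fun h => hcond (hiff.mp (spechtCharacter_injective h)))]
    rw [h0, mul_zero] at hC
    exact_mod_cast hC

/-! ### 10. The dual Cauchy identity `e_s(x ⊗ y) = ∑_{α ⊢ s} s_α(x) s_{αᵀ}(y)` at the generic point -/

/-- **Dual Cauchy identity, alternant form**: in `ℤ[y][x]` (`x = (X_i)`, `y = (C X_i)`, `n` letters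
each), for a finite set `ι` of size `s`,
`∑_{π ∈ 𝔖_ι} sign(π) · (a_ρ F_π)(x) · (a_ρ F_π)(y) = s! · ∑_{α ∈ ℕⁿ antitone, |α| = s, α_1 ≤ n}
a_{α+ρ}(x) a_{αᵀ+ρ}(y)`: expand both `a_ρ F_π` in alternants (`alternant_mul_fixedWordPoly_eq_sum`)
and use the signed orthogonality `sum_sign_mul_frobeniusChar_mul_frobeniusChar`.
[cite: Macdonald1995, Ch. I §4 (4.3')] -/
theorem sum_sign_mul_map_mul_C_eq {n : ℕ} {ι : Type*} [Fintype ι] [DecidableEq ι] :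
    ∑ π : Perm ι, ((Equiv.Perm.sign π : ℤ) : MvPolynomial (Fin n) (MvPolynomial (Fin n) ℤ)) *
      (MvPolynomial.map (C : ℤ →+* MvPolynomial (Fin n) ℤ)
          (alternant (fun i => (X i : MvPolynomial (Fin n) ℤ)) (rho n) * fixedWordPoly n π) *
        C (alternant (fun i => (X i : MvPolynomial (Fin n) ℤ)) (rho n) * fixedWordPoly n π)) =
      ((Fintype.card ι).factorial : MvPolynomial (Fin n) (MvPolynomial (Fin n) ℤ)) *
        ∑ α ∈ antitoneWeights n (Fintype.card ι),
          if (∀ i, α i ≤ n) then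
            MvPolynomial.map (C : ℤ →+* MvPolynomial (Fin n) ℤ)
                (alternant (fun i => (X i : MvPolynomial (Fin n) ℤ)) (α + rho n)) *
              C (alternant (fun i => (X i : MvPolynomial (Fin n) ℤ)) (conjVec n α + rho n))
          else 0 := by
  set s := Fintype.card ι with hs
  set ιx : MvPolynomial (Fin n) ℤ →+* MvPolynomial (Fin n) (MvPolynomial (Fin n) ℤ) :=
    MvPolynomial.map (C : ℤ →+* MvPolynomial (Fin n) ℤ) with hιx
  set ιy : MvPolynomial (Fin n) ℤ →+* MvPolynomial (Fin n) (MvPolynomial (Fin n) ℤ) :=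
    (C : MvPolynomial (Fin n) ℤ →+* MvPolynomial (Fin n) (MvPolynomial (Fin n) ℤ)) with hιy
  set A : (Fin n → ℕ) → MvPolynomial (Fin n) (MvPolynomial (Fin n) ℤ) := fun γ =>
    ιx (alternant (fun i => (X i : MvPolynomial (Fin n) ℤ)) (γ + rho n)) with hA
  set B : (Fin n → ℕ) → MvPolynomial (Fin n) (MvPolynomial (Fin n) ℤ) := fun γ =>
    ιy (alternant (fun i => (X i : MvPolynomial (Fin n) ℤ)) (γ + rho n)) with hB
  -- expand both factors
  have hexp : ∀ π : Perm ι,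
      ((Equiv.Perm.sign π : ℤ) : MvPolynomial (Fin n) (MvPolynomial (Fin n) ℤ)) *
        (ιx (alternant (fun i => (X i : MvPolynomial (Fin n) ℤ)) (rho n) * fixedWordPoly n π) *
          ιy (alternant (fun i => (X i : MvPolynomial (Fin n) ℤ)) (rho n) * fixedWordPoly n π)) =
      ∑ p ∈ antitoneWeights n s ×ˢ antitoneWeights n s,
        C (C ((Equiv.Perm.sign π : ℤ) * (frobeniusChar n p.1 π * frobeniusChar n p.2 π))) *
          (A p.1 * B p.2) := by
    intro π
    have hC : ((Equiv.Perm.sign π : ℤ) : MvPolynomial (Fin n) (MvPolynomial (Fin n) ℤ)) =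
        C (C (Equiv.Perm.sign π : ℤ)) := by simp
    rw [alternant_mul_fixedWordPoly_eq_sum π, map_sum, map_sum, Finset.sum_mul_sum,
      ← Finset.sum_product', Finset.mul_sum]
    refine Finset.sum_congr rfl fun p _ => ?_
    simp only [hA, hB, map_mul, hιx, hιy, map_C, hC]
    ring
  rw [Fintype.sum_congr _ _ hexp, Finset.sum_comm]
  simp_rw [← Finset.sum_mul, ← map_sum]
  have hinner : ∀ p ∈ antitoneWeights n s ×ˢ antitoneWeights n s,
      C (C (∑ π : Perm ι, (Equiv.Perm.sign π : ℤ) * (frobeniusChar n p.1 π * frobeniusChar n p.2 π))) *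
          (A p.1 * B p.2) =
        if (∀ i, p.1 i ≤ n) ∧ p.2 = conjVec n p.1 then
          (s.factorial : MvPolynomial (Fin n) (MvPolynomial (Fin n) ℤ)) * (A p.1 * B p.2) else 0 := by
    intro p hp
    rw [Finset.mem_product] at hp
    rw [sum_sign_mul_frobeniusChar_mul_frobeniusChar hp.1 hp.2]
    by_cases h : (∀ i, p.1 i ≤ n) ∧ p.2 = conjVec n p.1
    · rw [if_pos h, if_pos h, hs, map_natCast, map_natCast]
    · rw [if_neg h, if_neg h, map_zero, map_zero, zero_mul]
  rw [Finset.sum_congr rfl hinner, Finset.sum_product, Finset.mul_sum]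
  refine Finset.sum_congr rfl fun γ hγ => ?_
  by_cases hle : ∀ i, γ i ≤ n
  · rw [if_pos hle]
    have : ∀ δ ∈ antitoneWeights n s,
        (if (∀ i, γ i ≤ n) ∧ δ = conjVec n γ then
          (s.factorial : MvPolynomial (Fin n) (MvPolynomial (Fin n) ℤ)) * (A γ * B δ) else 0) =
        if δ = conjVec n γ then
          (s.factorial : MvPolynomial (Fin n) (MvPolynomial (Fin n) ℤ)) * (A γ * B δ) else 0 :=
      fun δ _ => by
        by_cases h : δ = conjVec n γ
        · rw [if_pos ⟨hle, h⟩, if_pos h]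
        · rw [if_neg (fun h' => h h'.2), if_neg h]
    rw [Finset.sum_congr rfl this, Finset.sum_ite_eq', if_pos (conjVec_mem_antitoneWeights hγ hle)]
  · rw [if_neg hle, mul_zero]
    exact Finset.sum_eq_zero fun δ _ => if_neg fun h => hle h.1

/-- **Dual Cauchy identity** (Macdonald I (4.3'): `∏_{i,j} (1 + x_i y_j) = ∑_λ s_λ(x) s_{λ'}(y)`), in
degree `s`, at the generic point of `ℤ[y][x]` with `n` letters in each alphabet:
`e_s(x ⊗ y) = ∑_{|S| = s} ∏_{(i,j) ∈ S} x_i y_j = ∑_{α ∈ ℕⁿ antitone, |α| = s, α_1 ≤ n} s_α(x) s_{αᵀ}(y)`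
(for `α_1 > n` the conjugate has more than `n` parts and `s_{αᵀ}(y) = 0`). From the signed Burnside
count `∑_π sign(π) F_π(x) F_π(y) = s! e_s(x ⊗ y)`, the alternant form `sum_sign_mul_map_mul_C_eq`
and the bialternant formula, cancelling `s! a_ρ(x) a_ρ(y) ≠ 0`. [cite: Macdonald1995, Ch. I §4 (4.3')] -/
theorem sum_powersetCard_prod_eq_sum_schur_mul_schur_conjVec (n s : ℕ) :
    ∑ S ∈ powersetCard s (univ : Finset (Fin n × Fin n)),
        ∏ q ∈ S, ((X q.1 : MvPolynomial (Fin n) (MvPolynomial (Fin n) ℤ)) * C (X q.2)) =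
      ∑ α ∈ antitoneWeights n s,
        if (∀ i, α i ≤ n) then
          schur (fun i => (X i : MvPolynomial (Fin n) (MvPolynomial (Fin n) ℤ))) α *
            schur (fun i => (C (X i) : MvPolynomial (Fin n) (MvPolynomial (Fin n) ℤ))) (conjVec n α)
        else 0 := by
  set x : Fin n → MvPolynomial (Fin n) (MvPolynomial (Fin n) ℤ) := fun i => X i with hxdef
  set y : Fin n → MvPolynomial (Fin n) (MvPolynomial (Fin n) ℤ) := fun i => C (X i) with hydef
  set ιx : MvPolynomial (Fin n) ℤ →+* MvPolynomial (Fin n) (MvPolynomial (Fin n) ℤ) :=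
    MvPolynomial.map (C : ℤ →+* MvPolynomial (Fin n) ℤ) with hιx
  set ιy : MvPolynomial (Fin n) ℤ →+* MvPolynomial (Fin n) (MvPolynomial (Fin n) ℤ) :=
    (C : MvPolynomial (Fin n) ℤ →+* MvPolynomial (Fin n) (MvPolynomial (Fin n) ℤ)) with hιy
  have hx : ((ιx : MvPolynomial (Fin n) ℤ →+* _) ∘ fun i => (X i : MvPolynomial (Fin n) ℤ)) = x := by
    funext i; simp [hιx, hxdef]
  have hy : ((ιy : MvPolynomial (Fin n) ℤ →+* _) ∘ fun i => (X i : MvPolynomial (Fin n) ℤ)) = y := by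
    funext i; simp [hιy, hydef]
  -- signed Burnside with `ι = Fin s`, both alphabets, times `a_ρ(x) a_ρ(y)`
  have h1 := sum_sign_mul_sum_fixed_prod_eq (ι := Fin s) (fun q : Fin n × Fin n => x q.1 * y q.2)
  rw [Fintype.card_fin] at h1
  have h2 : alternant x (rho n) * alternant y (rho n) *
      ∑ π : Perm (Fin s), ((Equiv.Perm.sign π : ℤ) : MvPolynomial (Fin n) (MvPolynomial (Fin n) ℤ)) *
        ∑ u ∈ univ.filter (fun u : Fin s → Fin n × Fin n => u ∘ ⇑π = u), ∏ q, (x (u q).1 * y (u q).2) =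
      ∑ π : Perm (Fin s), ((Equiv.Perm.sign π : ℤ) : MvPolynomial (Fin n) (MvPolynomial (Fin n) ℤ)) *
        (ιx (alternant (fun i => (X i : MvPolynomial (Fin n) ℤ)) (rho n) * fixedWordPoly n π) *
          ιy (alternant (fun i => (X i : MvPolynomial (Fin n) ℤ)) (rho n) * fixedWordPoly n π)) := by
    rw [Finset.mul_sum]
    refine Finset.sum_congr rfl fun π _ => ?_
    rw [map_mul, map_mul, map_alternant, map_alternant, hx, hy, ringHom_fixedWordPoly,
      ringHom_fixedWordPoly, ← sum_fixed_mul_sum_fixed']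
    simp only [hιx, hιy, map_X]
    ring
  rw [sum_sign_mul_map_mul_C_eq, h1] at h2
  -- rewrite the right-hand side with Schur polynomials
  have h3 : ∑ α ∈ antitoneWeights n s,
      (if (∀ i, α i ≤ n) then
        ιx (alternant (fun i => (X i : MvPolynomial (Fin n) ℤ)) (α + rho n)) *
          ιy (alternant (fun i => (X i : MvPolynomial (Fin n) ℤ)) (conjVec n α + rho n)) else 0) =
      alternant x (rho n) * alternant y (rho n) *
        ∑ α ∈ antitoneWeights n s,
          (if (∀ i, α i ≤ n) then schur x α * schur y (conjVec n α) else 0) := by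
    rw [Finset.mul_sum]
    refine Finset.sum_congr rfl fun α _ => ?_
    split_ifs
    · rw [map_alternant, map_alternant, hx, hy, alternant_add_rho, alternant_add_rho]; ring
    · rw [mul_zero]
  rw [Fintype.card_fin, h3, nsmul_eq_mul] at h2
  -- cancel `a_ρ(x) a_ρ(y) · s!`
  have hax : alternant x (rho n) ≠ 0 := alternant_rho_ne_zero (MvPolynomial.X_injective)
  have hay : alternant y (rho n) ≠ 0 :=
    alternant_rho_ne_zero ((MvPolynomial.C_injective _ _).comp MvPolynomial.X_injective)
  have hfac : (s.factorial : MvPolynomial (Fin n) (MvPolynomial (Fin n) ℤ)) ≠ 0 := by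
    exact_mod_cast s.factorial_ne_zero
  have h4 : alternant x (rho n) * alternant y (rho n) *
      ((s.factorial : MvPolynomial (Fin n) (MvPolynomial (Fin n) ℤ)) *
        ∑ S ∈ powersetCard s (univ : Finset (Fin n × Fin n)), ∏ q ∈ S, (x q.1 * y q.2)) =
      alternant x (rho n) * alternant y (rho n) *
      ((s.factorial : MvPolynomial (Fin n) (MvPolynomial (Fin n) ℤ)) *
        ∑ α ∈ antitoneWeights n s,
          (if (∀ i, α i ≤ n) then schur x α * schur y (conjVec n α) else 0)) := by
    rw [h2]; ring
  exact mul_left_cancel₀ hfac (mul_left_cancel₀ (mul_ne_zero hax hay) h4)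

end IP17Hook

/-! ### 11. `E'(r,s)` for two equal rectangles `(aⁿ)`: the number of self-conjugate partitions of
`s` inside the box -/

/-- One term of the Cauchy × dual Cauchy expansion in `ℤ[y][x]`: for the generic alphabets
`x = (X_i)`, `y = (C X_i)`,
`a_ρ(x) a_ρ(y) · (s_β(x) s_β(y)) · (s_γ(x) s_δ(y)) = (a_{γ+ρ} s_β)(x) · (a_{δ+ρ} s_β)(y)`
(bialternant formula). [folklore] -/
private theorem alternant_mul_schur_mul_schur_eq_map_mul_C₄ {n : ℕ} (β γ δ : Fin n → ℕ) :
    alternant (fun i => (X i : MvPolynomial (Fin n) (MvPolynomial (Fin n) ℤ))) (rho n) *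
        alternant (fun i => (C (X i) : MvPolynomial (Fin n) (MvPolynomial (Fin n) ℤ))) (rho n) *
        (schur (fun i => (X i : MvPolynomial (Fin n) (MvPolynomial (Fin n) ℤ))) β *
            schur (fun i => (C (X i) : MvPolynomial (Fin n) (MvPolynomial (Fin n) ℤ))) β *
          (schur (fun i => (X i : MvPolynomial (Fin n) (MvPolynomial (Fin n) ℤ))) γ *
            schur (fun i => (C (X i) : MvPolynomial (Fin n) (MvPolynomial (Fin n) ℤ))) δ)) =
      MvPolynomial.map (C : ℤ →+* MvPolynomial (Fin n) ℤ)
          (alternant (fun i => (X i : MvPolynomial (Fin n) ℤ)) (γ + rho n) *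
            schur (fun i => (X i : MvPolynomial (Fin n) ℤ)) β) *
        C (alternant (fun i => (X i : MvPolynomial (Fin n) ℤ)) (δ + rho n) *
            schur (fun i => (X i : MvPolynomial (Fin n) ℤ)) β) := by
  have hx : (⇑(MvPolynomial.map (C : ℤ →+* MvPolynomial (Fin n) ℤ)) ∘
      fun i : Fin n => (X i : MvPolynomial (Fin n) ℤ)) =
        fun i => (X i : MvPolynomial (Fin n) (MvPolynomial (Fin n) ℤ)) :=
    funext fun i => map_X _ i
  have hy : (⇑(C : MvPolynomial (Fin n) ℤ →+* MvPolynomial (Fin n) (MvPolynomial (Fin n) ℤ)) ∘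
      fun i : Fin n => (X i : MvPolynomial (Fin n) ℤ)) =
        fun i => (C (X i) : MvPolynomial (Fin n) (MvPolynomial (Fin n) ℤ)) := rfl
  rw [map_mul, map_mul, map_alternant, map_schur, map_alternant, map_schur, hx, hy,
    alternant_add_rho, alternant_add_rho]
  ring

/-- The box complement is an involution on the weights inside the box. [folklore] -/
private theorem boxCompl_boxCompl {n : ℕ} (a : ℕ) {α : Fin n → ℕ} (hα : ∀ i, α i ≤ a) :
    (fun j => a - (fun j' => a - α (Fin.rev j')) (Fin.rev j)) = α := by
  funext j
  simp only [Fin.rev_rev]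
  have := hα j
  omega

/-- **`E'(r,s)` for two equal rectangles**: for `r + s = n·a`,
`[x^{a𝟙+ρ} y^{a𝟙+ρ}] ( a_ρ(x) a_ρ(y) h_r(x⊗y) e_s(x⊗y) ) = ∑_{β ⊢ r, α ⊢ s} c^{(aⁿ)}_{βα} c^{(aⁿ)}_{βαᵀ}
= #{α ∈ ℕⁿ antitone : |α| = s, α ⊆ (aⁿ), αᵀ = α}` — Cauchy's identity, the dual Cauchy identity,
the bialternant formula, and the Littlewood–Richardson rule for the rectangle
(`coeff_rect_alternant_mul_schur`: `c^{(aⁿ)}_{βα} = [β = complement of α]`), so that only the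
SELF-CONJUGATE `α` inside the box survive (Ikenmeyer–Panova: "the partitions `θ ⊢ k` such that
`θ = θᵀ` and `θ ⊂ (d × n)`"). [cite: IkenmeyerPanova2017, proof of Prop. 6.4 (TeX L1399–1410)] -/
theorem coeff_coeff_rect_hook_eq_card {n : ℕ} (a : ℕ) {r s : ℕ} (hrs : r + s = n * a) :
    coeff (Finsupp.equivFunOnFinite.symm fun j => a + rho n j)
        (coeff (Finsupp.equivFunOnFinite.symm fun j => a + rho n j)
          (alternant (fun i => (X i : MvPolynomial (Fin n) (MvPolynomial (Fin n) ℤ))) (rho n) *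
            alternant (fun i => (C (X i) : MvPolynomial (Fin n) (MvPolynomial (Fin n) ℤ))) (rho n) *
            ((∑ M ∈ piAntidiag (univ : Finset (Fin n × Fin n)) r,
                ∏ q : Fin n × Fin n,
                  ((X q.1 : MvPolynomial (Fin n) (MvPolynomial (Fin n) ℤ)) * C (X q.2)) ^ M q) *
              (∑ S ∈ powersetCard s (univ : Finset (Fin n × Fin n)),
                ∏ q ∈ S, ((X q.1 : MvPolynomial (Fin n) (MvPolynomial (Fin n) ℤ)) * C (X q.2)))))) =
      (((antitoneWeights n s).filter fun α => (∀ i, α i ≤ a) ∧ IP17Hook.conjVec n α = α).card : ℤ) := by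
  rw [sum_piAntidiag_prod_pow_eq_sum_schur_mul_schur
      (fun i => (X i : MvPolynomial (Fin n) (MvPolynomial (Fin n) ℤ)))
      (fun i => (C (X i) : MvPolynomial (Fin n) (MvPolynomial (Fin n) ℤ))) r,
    IP17Hook.sum_powersetCard_prod_eq_sum_schur_mul_schur_conjVec n s,
    Finset.sum_mul_sum, Finset.mul_sum]
  simp_rw [Finset.mul_sum, coeff_sum]
  -- each term
  have hterm : ∀ β ∈ antitoneWeights n r, ∀ γ ∈ antitoneWeights n s,
      coeff (Finsupp.equivFunOnFinite.symm fun j => a + rho n j)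
        (coeff (Finsupp.equivFunOnFinite.symm fun j => a + rho n j)
          (alternant (fun i => (X i : MvPolynomial (Fin n) (MvPolynomial (Fin n) ℤ))) (rho n) *
            alternant (fun i => (C (X i) : MvPolynomial (Fin n) (MvPolynomial (Fin n) ℤ))) (rho n) *
            (schur (fun i => (X i : MvPolynomial (Fin n) (MvPolynomial (Fin n) ℤ))) β *
                schur (fun i => (C (X i) : MvPolynomial (Fin n) (MvPolynomial (Fin n) ℤ))) β *
              (if (∀ i, γ i ≤ n) then
                schur (fun i => (X i : MvPolynomial (Fin n) (MvPolynomial (Fin n) ℤ))) γ *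
                  schur (fun i => (C (X i) : MvPolynomial (Fin n) (MvPolynomial (Fin n) ℤ)))
                    (IP17Hook.conjVec n γ)
              else 0)))) =
        if (∀ i, β i ≤ a) ∧ γ = (fun j => a - β (Fin.rev j)) ∧ IP17Hook.conjVec n γ = γ
        then (1 : ℤ) else 0 := by
    intro β hβ γ hγ
    have hβa := (mem_antitoneWeights.mp hβ).2
    have hγa := (mem_antitoneWeights.mp hγ).2
    by_cases hle : ∀ i, γ i ≤ n
    · rw [if_pos hle, alternant_mul_schur_mul_schur_eq_map_mul_C₄, coeff_coeff_map_mul_C',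
        coeff_rect_alternant_mul_schur a hβa hγa,
        coeff_rect_alternant_mul_schur a hβa (IP17Hook.conjVec_antitone n γ)]
      by_cases h1 : (∀ i, β i ≤ a) ∧ γ = (fun j => a - β (Fin.rev j))
      · rw [if_pos h1]
        by_cases h2 : IP17Hook.conjVec n γ = γ
        · rw [if_pos (show (∀ i, β i ≤ a) ∧ IP17Hook.conjVec n γ = (fun j => a - β (Fin.rev j)) from
              ⟨h1.1, h2.trans h1.2⟩),
            if_pos (show (∀ i, β i ≤ a) ∧ γ = (fun j => a - β (Fin.rev j)) ∧ IP17Hook.conjVec n γ = γ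
              from ⟨h1.1, h1.2, h2⟩), mul_one]
        · rw [if_neg (show ¬ ((∀ i, β i ≤ a) ∧ IP17Hook.conjVec n γ = (fun j => a - β (Fin.rev j)))
              from fun h => h2 (h.2.trans h1.2.symm)),
            if_neg (show ¬ ((∀ i, β i ≤ a) ∧ γ = (fun j => a - β (Fin.rev j)) ∧
              IP17Hook.conjVec n γ = γ) from fun h => h2 h.2.2), mul_zero]
      · rw [if_neg h1, if_neg (show ¬ ((∀ i, β i ≤ a) ∧ γ = (fun j => a - β (Fin.rev j)) ∧
              IP17Hook.conjVec n γ = γ) from fun h => h1 ⟨h.1, h.2.1⟩), zero_mul]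
    · rw [if_neg hle, mul_zero, mul_zero, coeff_zero, coeff_zero, if_neg]
      rintro ⟨-, -, h⟩
      exact hle fun i => by rw [← h]; exact IP17Hook.conjVec_le n γ i
  rw [Finset.sum_congr rfl fun β hβ => Finset.sum_congr rfl fun γ hγ => hterm β hβ γ hγ]
  -- the sum over `γ` selects the box complement of `β`
  have hrs' : s + r = n * a := by omega
  have hinner : ∀ β ∈ antitoneWeights n r,
      ∑ γ ∈ antitoneWeights n s,
        (if (∀ i, β i ≤ a) ∧ γ = (fun j => a - β (Fin.rev j)) ∧ IP17Hook.conjVec n γ = γ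
          then (1 : ℤ) else 0) =
      if (∀ i, β i ≤ a) ∧ IP17Hook.conjVec n (fun j => a - β (Fin.rev j)) = (fun j => a - β (Fin.rev j))
        then 1 else 0 := by
    intro β hβ
    by_cases hβa : ∀ i, β i ≤ a
    · have : ∀ γ ∈ antitoneWeights n s,
          (if (∀ i, β i ≤ a) ∧ γ = (fun j => a - β (Fin.rev j)) ∧ IP17Hook.conjVec n γ = γ
            then (1 : ℤ) else 0) =
          if γ = (fun j => a - β (Fin.rev j)) then
            (if IP17Hook.conjVec n (fun j => a - β (Fin.rev j)) = (fun j => a - β (Fin.rev j))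
              then 1 else 0) else 0 := by
        intro γ _
        by_cases h : γ = (fun j => a - β (Fin.rev j))
        · subst h
          by_cases h2 : IP17Hook.conjVec n (fun j => a - β (Fin.rev j)) = (fun j => a - β (Fin.rev j))
          · rw [if_pos ⟨hβa, rfl, h2⟩, if_pos rfl, if_pos h2]
          · rw [if_neg (fun h => h2 h.2.2), if_pos rfl, if_neg h2]
        · rw [if_neg (fun h' => h h'.2.1), if_neg h]
      rw [Finset.sum_congr rfl this, Finset.sum_ite_eq',
        if_pos (boxCompl_mem_antitoneWeights a hrs' hβ hβa)]
      by_cases h2 : IP17Hook.conjVec n (fun j => a - β (Fin.rev j)) = (fun j => a - β (Fin.rev j))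
      · rw [if_pos h2, if_pos ⟨hβa, h2⟩]
      · rw [if_neg h2, if_neg (fun h => h2 h.2)]
    · rw [if_neg (fun h => hβa h.1)]
      exact Finset.sum_eq_zero fun γ _ => if_neg fun h => hβa h.1
  rw [Finset.sum_congr rfl hinner, Finset.sum_boole, Nat.cast_inj]
  -- reindex by the box complement
  refine Finset.card_bij' (fun β _ => fun j => a - β (Fin.rev j)) (fun α _ => fun j => a - α (Fin.rev j))
    ?_ ?_ ?_ ?_
  · intro β hβ
    rw [Finset.mem_filter] at hβ ⊢
    exact ⟨boxCompl_mem_antitoneWeights a hrs' hβ.1 hβ.2.1, boxCompl_le a β, hβ.2.2⟩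
  · intro α hα
    rw [Finset.mem_filter] at hα ⊢
    refine ⟨boxCompl_mem_antitoneWeights a hrs hα.1 hα.2.1, boxCompl_le a α, ?_⟩
    rw [boxCompl_boxCompl a hα.2.1]
    exact hα.2.2
  · intro β hβ
    rw [Finset.mem_filter] at hβ
    exact boxCompl_boxCompl a hβ.2.1
  · intro α hα
    rw [Finset.mem_filter] at hα
    exact boxCompl_boxCompl a hα.2.1

/-! ### 12. Self-conjugate partitions with at most `n` rows ↔ distinct odd parts `≤ 2n - 1` -/

namespace IP17Hook

/-- Splitting a count over `Fin (n+1)` at the last index. [folklore] -/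
private theorem card_filter_lt_succ_eq_castSucc {n : ℕ} (γ : Fin (n + 1) → ℕ) (j : ℕ) :
    ((univ : Finset (Fin (n + 1))).filter fun i => j < γ i).card =
      ((univ : Finset (Fin n)).filter fun i => j < γ (Fin.castSucc i)).card +
        (if j < γ (Fin.last n) then 1 else 0) := by
  rw [Finset.card_filter, Finset.card_filter, Fin.sum_univ_castSucc]

/-- Splitting a count over `Fin (n+1)` at the first index. [folklore] -/
private theorem card_filter_lt_succ_eq_succ {n : ℕ} (γ : Fin (n + 1) → ℕ) (j : ℕ) :
    ((univ : Finset (Fin (n + 1))).filter fun i => j < γ i).card =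
      (if j < γ 0 then 1 else 0) +
        ((univ : Finset (Fin n)).filter fun i => j < γ (Fin.succ i)).card := by
  rw [Finset.card_filter, Finset.card_filter, Fin.sum_univ_succ]

/-- A self-conjugate weight in `n` letters has all entries `≤ n`. [folklore] -/
private theorem le_of_conjVec_eq {n : ℕ} {α : Fin n → ℕ} (h : conjVec n α = α) (i : Fin n) : α i ≤ n := by
  rw [← h]; exact conjVec_le n α i

/-- The recursion of the subset counts: a set of distinct odd parts `≤ 2n + 1` either avoids the
part `2n + 1` or contains it. [cite: IkenmeyerPanova2017, proof of Prop. 6.4 (6.7)] -/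
theorem oddPartsSubsetCount_one_succ_right (n s : ℕ) :
    oddPartsSubsetCount 1 (n + 1) s =
      oddPartsSubsetCount 1 n s + (if 2 * n + 1 ≤ s then oddPartsSubsetCount 1 n (s - (2 * n + 1)) else 0) := by
  unfold oddPartsSubsetCount
  have hU : Finset.Icc 1 (n + 1) = insert (n + 1) (Finset.Icc 1 n) := by
    ext i
    simp only [Finset.mem_insert, Finset.mem_Icc]
    omega
  have h1 : (n + 1 : ℕ) ∉ Finset.Icc 1 n := by simp
  have hnot : ∀ S ∈ (Finset.Icc 1 n).powerset, (n + 1 : ℕ) ∉ S := fun S hS h =>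
    h1 (Finset.mem_powerset.mp hS h)
  rw [hU, Finset.powerset_insert, Finset.filter_union, Finset.card_union_of_disjoint]
  · congr 1
    rw [Finset.filter_image, Finset.card_image_of_injOn]
    · split_ifs with hs
      · congr 1
        apply Finset.filter_congr
        intro S hS
        rw [Finset.sum_insert (hnot S hS)]
        omega
      · rw [Finset.card_eq_zero, Finset.filter_eq_empty_iff]
        intro S hS h
        rw [Finset.sum_insert (hnot S hS)] at h
        omega
    · intro S₁ hS₁ S₂ hS₂ h
      have e₁ := Finset.erase_insert (hnot S₁ (Finset.mem_filter.mp (Finset.mem_coe.mp hS₁)).1)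
      have e₂ := Finset.erase_insert (hnot S₂ (Finset.mem_filter.mp (Finset.mem_coe.mp hS₂)).1)
      rw [← e₁, ← e₂, h]
  · rw [Finset.disjoint_left]
    intro S hS hS'
    rw [Finset.mem_filter] at hS hS'
    obtain ⟨S', -, rfl⟩ := Finset.mem_image.mp hS'.1
    exact hnot _ hS.1 (Finset.mem_insert_self _ S')

/-- No letters: the only weight is the empty one, of size `0`. [cite: IkenmeyerPanova2017, proof of Prop. 6.4 (6.7)] -/
theorem card_selfConj_zero (s : ℕ) :
    ((antitoneWeights 0 s).filter fun α => conjVec 0 α = α).card = if s = 0 then 1 else 0 := by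
  split_ifs with hs
  · subst hs
    rw [Finset.card_eq_one]
    refine ⟨fun i => i.elim0, ?_⟩
    ext α
    simp only [Finset.mem_filter, mem_antitoneWeights, Finset.mem_singleton, Finset.univ_eq_empty,
      Finset.sum_empty, true_and]
    constructor
    · intro _; funext i; exact i.elim0
    · intro _
      exact ⟨fun i => i.elim0, funext fun i => i.elim0⟩
  · rw [Finset.card_eq_zero, Finset.filter_eq_empty_iff]
    intro α hα
    rw [mem_antitoneWeights, Finset.univ_eq_empty, Finset.sum_empty] at hα
    exact absurd hα.1 (Ne.symm hs)

/-- **Restriction**: the self-conjugate weights `α` in `n + 1` letters with `α_0 ≤ n` are the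
self-conjugate weights in `n` letters, padded by `α_n = 0`. [cite: IkenmeyerPanova2017, proof of Prop. 6.4 (6.7)] -/
theorem card_selfConj_succ_filter_le (n s : ℕ) :
    (((antitoneWeights (n + 1) s).filter fun α => conjVec (n + 1) α = α).filter
        fun α => α 0 ≤ n).card =
      ((antitoneWeights n s).filter fun α => conjVec n α = α).card := by
  refine Finset.card_bij' (fun α _ => fun i : Fin n => α (Fin.castSucc i))
    (fun β _ => fun i : Fin (n + 1) => if h : (i : ℕ) < n then β ⟨i, h⟩ else 0) ?_ ?_ ?_ ?_
  · intro α hα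
    simp only [Finset.mem_filter, mem_antitoneWeights] at hα ⊢
    obtain ⟨⟨⟨hsum, hanti⟩, hconj⟩, h0⟩ := hα
    have hle : ∀ i, α i ≤ n := fun i => (hanti (Fin.zero_le i)).trans h0
    have hlast : α (Fin.last n) = 0 := by
      have := congr_fun hconj (Fin.last n)
      rw [← this, conjVec, Finset.card_eq_zero, Finset.filter_eq_empty_iff]
      intro i _
      simp only [Fin.val_last, not_lt]
      exact hle i
    refine ⟨⟨?_, fun a b hab => hanti (Fin.castSucc_le_castSucc_iff.mpr hab)⟩, ?_⟩
    · rw [Fin.sum_univ_castSucc, hlast, add_zero] at hsum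
      exact hsum
    · funext j
      have := congr_fun hconj (Fin.castSucc j)
      rw [conjVec, card_filter_lt_succ_eq_castSucc, hlast] at this
      simp only [Fin.val_castSucc, not_lt_zero, if_false, add_zero] at this
      rw [conjVec]
      exact this
  · intro β hβ
    simp only [Finset.mem_filter, mem_antitoneWeights] at hβ ⊢
    obtain ⟨⟨hsum, hanti⟩, hconj⟩ := hβ
    have hle : ∀ i, β i ≤ n := le_of_conjVec_eq hconj
    have hcast : ∀ i : Fin n,
        (if h : ((Fin.castSucc i : Fin (n + 1)) : ℕ) < n then β ⟨(Fin.castSucc i : ℕ), h⟩ else 0) = β i := by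
      intro i; simp [i.is_lt]
    have hlast : (if h : ((Fin.last n : Fin (n + 1)) : ℕ) < n then β ⟨(Fin.last n : ℕ), h⟩ else 0) = 0 := by
      simp
    refine ⟨⟨⟨?_, ?_⟩, ?_⟩, ?_⟩
    · rw [Fin.sum_univ_castSucc, hlast, add_zero]
      simp_rw [hcast]
      exact hsum
    · intro a b hab
      have hab' : (a : ℕ) ≤ b := hab
      dsimp only
      by_cases hb : (b : ℕ) < n
      · rw [dif_pos hb, dif_pos (lt_of_le_of_lt hab' hb)]
        exact hanti (Fin.mk_le_mk.mpr hab')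
      · rw [dif_neg hb]; exact Nat.zero_le _
    · funext j
      rw [conjVec, card_filter_lt_succ_eq_castSucc, hlast]
      simp_rw [hcast]
      simp only [not_lt_zero, if_false, add_zero]
      by_cases hj : (j : ℕ) < n
      · rw [dif_pos hj]
        have := congr_fun hconj ⟨j, hj⟩
        rw [conjVec] at this
        exact this
      · rw [dif_neg hj, Finset.card_eq_zero, Finset.filter_eq_empty_iff]
        intro i _
        have := hle i
        have hjn : (j : ℕ) = n := by have := j.is_lt; omega
        omega
    · by_cases hn : (0 : ℕ) < n
      · rw [dif_pos (by simpa using hn)]; exact hle _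
      · rw [dif_neg (by simpa using hn)]; exact Nat.zero_le _
  · intro α hα
    simp only [Finset.mem_filter, mem_antitoneWeights] at hα
    obtain ⟨⟨⟨-, hanti⟩, hconj⟩, h0⟩ := hα
    have hle : ∀ i, α i ≤ n := fun i => (hanti (Fin.zero_le i)).trans h0
    funext i
    dsimp only
    by_cases hi : (i : ℕ) < n
    · rw [dif_pos hi]; rfl
    · rw [dif_neg hi]
      have hin : i = Fin.last n := Fin.ext (by have := i.is_lt; simp; omega)
      rw [hin]
      have := congr_fun hconj (Fin.last n)
      rw [← this, conjVec, eq_comm, Finset.card_eq_zero, Finset.filter_eq_empty_iff]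
      intro i' _
      simp only [Fin.val_last, not_lt]
      exact hle i'
  · intro β _
    funext i
    simp [i.is_lt]

/-- **Removing the outer hook**: the self-conjugate weights `α` in `n + 1` letters with
`α_0 = n + 1` (outer hook of size `2n + 1`) are in bijection with the self-conjugate weights in `n`
letters of size `|α| - (2n + 1)`, via `β_i = α_{i+1} - 1`. [cite: IkenmeyerPanova2017, proof of Prop. 6.4 (6.7) (the diagonal hook division)] -/
theorem card_selfConj_succ_filter_eq (n s : ℕ) :
    (((antitoneWeights (n + 1) s).filter fun α => conjVec (n + 1) α = α).filter
        fun α => α 0 = n + 1).card =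
      if 2 * n + 1 ≤ s then
        ((antitoneWeights n (s - (2 * n + 1))).filter fun α => conjVec n α = α).card
      else 0 := by
  -- every entry of such an `α` is positive
  have hpos : ∀ α : Fin (n + 1) → ℕ, conjVec (n + 1) α = α → α 0 = n + 1 → ∀ i, 1 ≤ α i := by
    intro α hconj h0 i
    have := congr_fun hconj i
    rw [← this, conjVec]
    refine Finset.card_pos.mpr ⟨0, ?_⟩
    simp only [Finset.mem_filter, Finset.mem_univ, true_and, h0]
    exact i.is_lt
  split_ifs with hs
  · refine Finset.card_bij' (fun α _ => fun i : Fin n => α (Fin.succ i) - 1)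
      (fun β _ => Fin.cons (n + 1) (fun i => β i + 1)) ?_ ?_ ?_ ?_
    · intro α hα
      simp only [Finset.mem_filter, mem_antitoneWeights] at hα ⊢
      obtain ⟨⟨⟨hsum, hanti⟩, hconj⟩, h0⟩ := hα
      have hp := hpos α hconj h0
      refine ⟨⟨?_, fun a b hab => Nat.sub_le_sub_right (hanti (Fin.succ_le_succ_iff.mpr hab)) 1⟩, ?_⟩
      · rw [Fin.sum_univ_succ, h0] at hsum
        rw [Finset.sum_tsub_distrib _ (fun i _ => hp (Fin.succ i)), Finset.sum_const, Finset.card_fin,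
          smul_eq_mul, mul_one]
        omega
      · funext j
        have hj := j.is_lt
        have hconj' := congr_fun hconj (Fin.succ j)
        rw [conjVec, card_filter_lt_succ_eq_succ, h0, Fin.val_succ, if_pos (by omega)] at hconj'
        rw [conjVec]
        have hfilt : ((univ : Finset (Fin n)).filter fun i => (j : ℕ) < α (Fin.succ i) - 1) =
            (univ : Finset (Fin n)).filter fun i => (j : ℕ) + 1 < α (Fin.succ i) := by
          apply Finset.filter_congr
          intro i _
          have := hp (Fin.succ i)
          omega
        rw [hfilt]
        omega
    · intro β hβ
      simp only [Finset.mem_filter, mem_antitoneWeights] at hβ ⊢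
      obtain ⟨⟨hsum, hanti⟩, hconj⟩ := hβ
      have hle : ∀ i, β i ≤ n := le_of_conjVec_eq hconj
      refine ⟨⟨⟨?_, ?_⟩, ?_⟩, Fin.cons_zero _ _⟩
      · rw [Fin.sum_univ_succ, Fin.cons_zero]
        simp only [Fin.cons_succ]
        rw [Finset.sum_add_distrib, hsum, Finset.sum_const, Finset.card_fin, smul_eq_mul, mul_one]
        omega
      · intro a b hab
        rcases Fin.eq_zero_or_eq_succ a with rfl | ⟨i, rfl⟩
        · rcases Fin.eq_zero_or_eq_succ b with rfl | ⟨j, rfl⟩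
          · exact le_rfl
          · rw [Fin.cons_zero, Fin.cons_succ]; have := hle j; omega
        · rcases Fin.eq_zero_or_eq_succ b with rfl | ⟨j, rfl⟩
          · exact absurd hab (by simp)
          · rw [Fin.cons_succ, Fin.cons_succ]
            exact Nat.add_le_add_right (hanti (Fin.succ_le_succ_iff.mp hab)) 1
      · funext j'
        rw [conjVec, card_filter_lt_succ_eq_succ, Fin.cons_zero]
        simp only [Fin.cons_succ]
        rcases Fin.eq_zero_or_eq_succ j' with rfl | ⟨j, rfl⟩
        · rw [Fin.cons_zero, Fin.val_zero, if_pos (Nat.succ_pos n)]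
          have : ((univ : Finset (Fin n)).filter fun i => 0 < β i + 1) = univ :=
            Finset.filter_true_of_mem fun i _ => Nat.succ_pos _
          rw [this, Finset.card_fin]
          omega
        · rw [Fin.cons_succ, Fin.val_succ, if_pos (by have := j.is_lt; omega)]
          have hfilt : ((univ : Finset (Fin n)).filter fun i => (j : ℕ) + 1 < β i + 1) =
              (univ : Finset (Fin n)).filter fun i => (j : ℕ) < β i := by
            apply Finset.filter_congr
            intro i _
            omega
          have := congr_fun hconj j
          rw [conjVec] at this
          rw [hfilt, this]
          omega
    · intro α hα
      simp only [Finset.mem_filter, mem_antitoneWeights] at hα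
      obtain ⟨⟨⟨-, -⟩, hconj⟩, h0⟩ := hα
      have hp := hpos α hconj h0
      funext i
      rcases Fin.eq_zero_or_eq_succ i with rfl | ⟨j, rfl⟩
      · rw [Fin.cons_zero, h0]
      · rw [Fin.cons_succ]
        exact Nat.sub_add_cancel (hp _)
    · intro β _
      funext i
      simp
  · rw [Finset.card_eq_zero, Finset.filter_eq_empty_iff]
    intro α hα h0
    simp only [Finset.mem_filter, mem_antitoneWeights] at hα
    obtain ⟨⟨hsum, -⟩, hconj⟩ := hα
    have hp := hpos α hconj h0
    rw [Fin.sum_univ_succ, h0] at hsum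
    have : n ≤ ∑ i : Fin n, α (Fin.succ i) := by
      calc n = ∑ _i : Fin n, 1 := by simp
        _ ≤ ∑ i : Fin n, α (Fin.succ i) := Finset.sum_le_sum fun i _ => hp (Fin.succ i)
    omega

/-- **Self-conjugate partitions versus distinct odd parts** (the classical bijection by diagonal
hooks, Ikenmeyer–Panova (6.7): "`g_k(d,n)` = number of partitions of `k` into distinct odd parts
`≤ 2d - 1`"): the number of antitone `α ∈ ℕⁿ` with `|α| = s` and `αᵀ = α` equals the number of
subsets of `{1, …, n}` with `∑ (2i - 1) = s` (`oddPartsSubsetCount 1 n s`). By induction on `n`: in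
`n + 1` letters such an `α` has `α_0 ≤ n` (then `α_n = 0`: restriction, `card_selfConj_succ_filter_le`)
or `α_0 = n + 1` (outer hook of length `2n + 1`, `card_selfConj_succ_filter_eq`), matching the
recursion `oddPartsSubsetCount_one_succ_right`. [cite: IkenmeyerPanova2017, proof of Prop. 6.4 (6.7) (TeX L1410–1420)] -/
theorem card_selfConj_eq_oddPartsSubsetCount (n s : ℕ) :
    ((antitoneWeights n s).filter fun α => conjVec n α = α).card = oddPartsSubsetCount 1 n s := by
  induction n generalizing s with
  | zero =>
    rw [card_selfConj_zero]
    unfold oddPartsSubsetCount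
    rw [show Finset.Icc 1 0 = ∅ by rfl, Finset.powerset_empty]
    split_ifs with hs
    · subst hs; rfl
    · symm
      rw [Finset.card_eq_zero, Finset.filter_eq_empty_iff]
      intro S hS
      rw [Finset.mem_singleton] at hS
      subst hS
      rw [Finset.sum_empty]
      exact Ne.symm hs
  | succ n ih =>
    rw [oddPartsSubsetCount_one_succ_right, ← ih s,
      ← Finset.card_filter_add_card_filter_not (fun α : Fin (n + 1) → ℕ => α 0 ≤ n),
      card_selfConj_succ_filter_le]
    congr 1
    have hneg : (((antitoneWeights (n + 1) s).filter fun α => conjVec (n + 1) α = α).filter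
        fun α => ¬ α 0 ≤ n) =
        (((antitoneWeights (n + 1) s).filter fun α => conjVec (n + 1) α = α).filter
          fun α => α 0 = n + 1) := by
      apply Finset.filter_congr
      intro α hα
      rw [Finset.mem_filter] at hα
      have := le_of_conjVec_eq hα.2 0
      omega
    rw [hneg, card_selfConj_succ_filter_eq]
    split_ifs with hs
    · rw [ih]
    · rfl

end IP17Hook

/-! ### 13. Ikenmeyer–Panova 2017, Prop. 6.4: `g((nd-k,1^k), d × n, d × n) = #{k as distinct parts
from {3, 5, …, 2d-1}}`, and Cor. 5.1 -/

/-- The hook `(D - j, 1^j) ⊢ D` exists for `j + 1 ≤ D`. [cite: IkenmeyerPanova2017, Prop. 6.4 (the hooks (nd-k, 1^k))] -/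
theorem exists_parts_eq_hook {D j : ℕ} (hj : j + 1 ≤ D) :
    ∃ lam : Nat.Partition D, lam.parts = (D - j) ::ₘ Multiset.replicate j 1 := by
  refine ⟨⟨(D - j) ::ₘ Multiset.replicate j 1, fun {x} hx => ?_, ?_⟩, rfl⟩
  · rcases Multiset.mem_cons.1 hx with rfl | hx
    · omega
    · rw [Multiset.eq_of_mem_replicate hx]; omega
  · rw [Multiset.sum_cons, Multiset.sum_replicate, smul_eq_mul, mul_one]
    omega

/-- A hook `(D - j, 1^j)` with parts as stated forces `j + 1 ≤ D` (all parts are positive). [folklore] -/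
private theorem succ_le_of_parts_eq_hook {D j : ℕ} {lam : Nat.Partition D}
    (hlam : lam.parts = (D - j) ::ₘ Multiset.replicate j 1) : j + 1 ≤ D := by
  have h : 0 < D - j := lam.parts_pos (by rw [hlam]; exact Multiset.mem_cons_self _ _)
  omega

/-- The padded parts vector of the rectangle `(aᵐ)` in `m` letters is constant `a`. [folklore] -/
private theorem getD_sortedParts_rectangle_fin' (m a : ℕ) (j : Fin m) :
    (Nat.Partition.rectangle m a).sortedParts.getD j 0 = a := by
  rcases Nat.eq_zero_or_pos a with rfl | ha
  · have h0 : (Nat.Partition.rectangle m 0).sortedParts = [] := by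
      rw [← List.length_eq_zero_iff, Nat.Partition.length_sortedParts]
      simp [Nat.Partition.rectangle, Nat.Partition.ofSums]
    rw [h0, List.getD_nil]
  · rw [Nat.Partition.sortedParts_rectangle _ _ ha.ne', List.getD_replicate _ j.2]

/-- Only the empty set of parts from `{3, 5, …, 2d-1}` has sum `0`. [folklore] -/
private theorem oddPartsSubsetCount_two_zero (d : ℕ) : oddPartsSubsetCount 2 d 0 = 1 := by
  unfold oddPartsSubsetCount
  rw [Finset.card_eq_one]
  refine ⟨∅, ?_⟩
  ext S
  simp only [Finset.mem_filter, Finset.mem_powerset, Finset.mem_singleton]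
  constructor
  · rintro ⟨hS, hsum⟩
    rw [Finset.sum_eq_zero_iff] at hsum
    ext i
    simp only [Finset.notMem_empty, iff_false]
    intro hi
    have h1 := hsum i hi
    have h2 := Finset.mem_Icc.mp (hS hi)
    omega
  · rintro rfl
    exact ⟨Finset.empty_subset _, Finset.sum_empty⟩

/-- **The hook Kronecker coefficients against two equal rectangles, in the tree's letters**: for
every `k` and every `λ ⊢ dn` with parts `(dn - k, 1, …, 1)` (`k` ones), `d ≤ n`,
`g(d × n, d × n, λ) = #{ways to write k as a sum of distinct parts from {3, 5, …, 2d-1}}`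
(`oddPartsSubsetCount 2 d k`). Induction on `k`: `k = 0` is `g((D), R, R) = 1`
(`kroneckerCoeff_indiscrete_eq`); the step is the master formula
`g(h_k) + g(h_{k-1}) = E'(D-k, k)` (`kroneckerCoeff_hook_add_hook_eq`), `E'(D-k,k)` = the number of
self-conjugate `α ⊢ k` with at most `d` rows (`coeff_coeff_rect_hook_eq_card`, the bound `α_i ≤ n`
being automatic as `α_i ≤ d ≤ n`), `= oddPartsSubsetCount 1 d k` (`card_selfConj_eq_oddPartsSubsetCount`)
`= oddPartsSubsetCount 2 d k + oddPartsSubsetCount 2 d (k-1)` (`oddPartsSubsetCount_one_succ`).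
[cite: IkenmeyerPanova2017, Prop. 6.4 and its proof (TeX L1381–1428)] -/
theorem kroneckerCoeff_rectangle_rectangle_hook {d n : ℕ} (hdn : d ≤ n) (k : ℕ)
    (lam : Nat.Partition (d * n)) (hlam : lam.parts = (d * n - k) ::ₘ Multiset.replicate k 1) :
    kroneckerCoeff ℂ (Nat.Partition.rectangle d n) (Nat.Partition.rectangle d n) lam =
      oddPartsSubsetCount 2 d k := by
  induction k generalizing lam with
  | zero =>
    have hD : 0 + 1 ≤ d * n := succ_le_of_parts_eq_hook hlam
    have hlam' : lam = Nat.Partition.indiscrete (d * n) := by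
      ext1
      rw [hlam, Nat.Partition.indiscrete_parts (by omega), Multiset.replicate_zero, Nat.sub_zero,
        Multiset.cons_zero]
    rw [hlam', kroneckerCoeff_comm₂₃_holds ℂ, kroneckerCoeff_comm₁₂_holds ℂ,
      Literature.Barriers.ValiantsHypothesis.kroneckerCoeff_indiscrete_eq, if_pos rfl,
      oddPartsSubsetCount_two_zero]
  | succ k ih =>
    have hkD : (k + 1) + 1 ≤ d * n := succ_le_of_parts_eq_hook hlam
    have hd : 1 ≤ d := by
      rcases Nat.eq_zero_or_pos d with rfl | hd
      · simp at hkD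
      · exact hd
    obtain ⟨lam', hlam'⟩ := exists_parts_eq_hook (D := d * n) (j := k) (by omega)
    have hprev := ih lam' hlam'
    have key := kroneckerCoeff_hook_add_hook_eq (b := d) (d := d) n n
      (Nat.Partition.rectangle d n) (Nat.Partition.rectangle d n)
      (Nat.Partition.card_parts_rectangle_le d n) (getD_sortedParts_rectangle_fin' d n)
      (Nat.Partition.card_parts_rectangle_le d n) (getD_sortedParts_rectangle_fin' d n)
      (k := k + 1) (by omega) hkD lam lam' hlam (by rw [hlam', Nat.add_sub_cancel])
    rw [coeff_coeff_rect_hook_eq_card n (r := d * n - (k + 1)) (s := k + 1) (by omega), hprev]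
      at key
    -- the box condition is automatic for self-conjugate weights with at most `d ≤ n` rows
    have hfilt : ((antitoneWeights d (k + 1)).filter fun α =>
        (∀ i, α i ≤ n) ∧ IP17Hook.conjVec d α = α) =
        (antitoneWeights d (k + 1)).filter fun α => IP17Hook.conjVec d α = α := by
      apply Finset.filter_congr
      intro α _
      constructor
      · exact fun h => h.2
      · exact fun h => ⟨fun i => (IP17Hook.le_of_conjVec_eq h i).trans hdn, h⟩
    rw [hfilt, IP17Hook.card_selfConj_eq_oddPartsSubsetCount,
      oddPartsSubsetCount_one_succ d k hd] at key
    push_cast at key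
    have : (kroneckerCoeff ℂ (Nat.Partition.rectangle d n) (Nat.Partition.rectangle d n) lam : ℤ) =
        oddPartsSubsetCount 2 d (k + 1) := by linarith
    exact_mod_cast this

/-- **Discharge of `ikenmeyerPanova2017_prop_6_4`** (Ikenmeyer–Panova, Adv. Math. 319 (2017),
Prop. 6.4: "the Kronecker coefficients `g((nd-k,1^k), d × n, d × n)` are equal to the number of
partitions of `k` into distinct parts from `{3, 5, …, 2d-1}` … `∑_k g_k(d,n) q^k =
∏_{i=2}^{d} (1+q^{2i-1})`"), by the printed proof (Littlewood's identity / the character form of the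
Kronecker product with `χ^{(1^k)} × χ^{(N-k)}`, the Littlewood–Richardson rule for rectangles,
self-conjugate partitions and their diagonal hooks), carried out with characters of `𝔖_D`.
[cite: IkenmeyerPanova2017, Prop. 6.4 (TeX L1381–1428; held: Proposition 31, chunk p0015)] -/
theorem ikenmeyerPanova2017_prop_6_4_holds : ikenmeyerPanova2017_prop_6_4 := by
  intro d n k hdn lam hlam
  rw [kroneckerCoeff_comm₁₂_holds ℂ, kroneckerCoeff_comm₂₃_holds ℂ]
  exact kroneckerCoeff_rectangle_rectangle_hook hdn k lam hlam

/-- **Discharge of `ikenmeyerPanova2017_cor_5_1`** (Ikenmeyer–Panova 2017, Cor. 5.1: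
"`a_ρ = 0` iff `ρ ∈ 𝔛`"), from the tree's reduction `ikenmeyerPanova2017_cor_5_1_of_prop_6_4`
(the bodies `(2,1)`, `(3,1)` certified in the kernel there, the hooks `(1), (1,1), (1⁴), (1⁶)` by
Prop. 6.4) and `ikenmeyerPanova2017_prop_6_4_holds`.
[cite: IkenmeyerPanova2017, Cor. 5.1 (TeX L1219–1229; held: Corollary 24, chunk p0013)] -/
theorem ikenmeyerPanova2017_cor_5_1_holds : ikenmeyerPanova2017_cor_5_1 :=
  ikenmeyerPanova2017_cor_5_1_of_prop_6_4 ikenmeyerPanova2017_prop_6_4_holds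

/-! ### 14. Theorem 6.1 of Ikenmeyer–Panova 2017, unconditionally

The tree's `ikenmeyerPanova2017_thm_6_1_zero/_table/_symm/_mono` and
`hook_kroneckerCoeff_eq_zero_of_prop_6_4` (`IP17KroneckerPositivity(Proofs).lean`) take Prop. 6.4 as the
hypothesis `h64 : ikenmeyerPanova2017_prop_6_4`; feeding `ikenmeyerPanova2017_prop_6_4_holds` gives the
printed statements with no hypothesis (the monotonicity clause keeps its genuine second input, Prop. 6.8 =
Pak–Panova 2014 Thm. 5.2, as the hypothesis `h68`). -/

/-- **Ikenmeyer–Panova 2017, Thm. 6.1, vanishing clause for `d ≥ 7`, unconditionally**: for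
`n ≥ d ≥ 7`, `g((nd - k, 1^k), d × n, d × n) = 0` whenever `k ∈ {1, 2, 4, 6, d² - 7, d² - 5, d² - 3, d² - 2}`
or `k ≥ d²` — the tree's `ikenmeyerPanova2017_thm_6_1_zero` with Prop. 6.4 supplied by
`ikenmeyerPanova2017_prop_6_4_holds`.
[cite: IkenmeyerPanova2017, Thm. 6.1 (vanishing clause, d ≥ 7; TeX L1340–1343; held: Theorem 28, chunk p0014)] -/
theorem IkenmeyerPanova2017.thm_6_1_zero {d n k : ℕ} (hd : 7 ≤ d) (hdn : d ≤ n)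
    (hk : k = 1 ∨ k = 2 ∨ k = 4 ∨ k = 6 ∨ k + 7 = d ^ 2 ∨ k + 5 = d ^ 2 ∨ k + 3 = d ^ 2 ∨
      k + 2 = d ^ 2 ∨ d ^ 2 ≤ k)
    (lam : Nat.Partition (d * n)) (hlam : lam.parts = (d * n - k) ::ₘ Multiset.replicate k 1) :
    kroneckerCoeff ℂ lam (Nat.Partition.rectangle d n) (Nat.Partition.rectangle d n) = 0 :=
  ikenmeyerPanova2017_thm_6_1_zero ikenmeyerPanova2017_prop_6_4_holds hd hdn hk lam hlam

/-- **Ikenmeyer–Panova 2017, Thm. 6.1, the table for `d ≤ 6`, unconditionally**: for `n ≥ d`,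
`d ≤ 6`, `g((nd - k, 1^k), d × n, d × n) = 0` if `k > d² - 1` or `k` is in the printed row of `d`
(`d = 6`: `{1, 2, 4, 6, 13, 22, 29, 31, 33, 34}`; `d = 5`: `{1, 2, 4, 6, 11, 13, 18, 20, 22, 23}`; `d = 4`:
`{1, 2, 4, 6, 9, 11, 13, 14}`; `d = 3`: `{1, 2, 4, 6, 7}`; `d = 2`: `{1, 2}`) — the tree's
`ikenmeyerPanova2017_thm_6_1_table` with Prop. 6.4 supplied by `ikenmeyerPanova2017_prop_6_4_holds`.
[cite: IkenmeyerPanova2017, Thm. 6.1 (table d ≤ 6; TeX L1344–1353; held: Theorem 28, chunk p0014)] -/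
theorem IkenmeyerPanova2017.thm_6_1_table {d n k : ℕ} (hd : d ≤ 6) (hdn : d ≤ n)
    (hk : d ^ 2 ≤ k ∨ (d = 6 ∧ k ∈ ({1, 2, 4, 6, 13, 22, 29, 31, 33, 34} : Finset ℕ)) ∨
      (d = 5 ∧ k ∈ ({1, 2, 4, 6, 11, 13, 18, 20, 22, 23} : Finset ℕ)) ∨
      (d = 4 ∧ k ∈ ({1, 2, 4, 6, 9, 11, 13, 14} : Finset ℕ)) ∨
      (d = 3 ∧ k ∈ ({1, 2, 4, 6, 7} : Finset ℕ)) ∨ (d = 2 ∧ k ∈ ({1, 2} : Finset ℕ)))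
    (lam : Nat.Partition (d * n)) (hlam : lam.parts = (d * n - k) ::ₘ Multiset.replicate k 1) :
    kroneckerCoeff ℂ lam (Nat.Partition.rectangle d n) (Nat.Partition.rectangle d n) = 0 :=
  ikenmeyerPanova2017_thm_6_1_table ikenmeyerPanova2017_prop_6_4_holds hd hdn hk lam hlam

/-- **Ikenmeyer–Panova 2017, Thm. 6.1, symmetry clause, unconditionally**: for `n ≥ d` and
`k + k' = d² - 1`, `g((nd - k, 1^k), d × n, d × n) = g((nd - k', 1^{k'}), d × n, d × n)` — the tree's
`ikenmeyerPanova2017_thm_6_1_symm` with Prop. 6.4 supplied by `ikenmeyerPanova2017_prop_6_4_holds`.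
[cite: IkenmeyerPanova2017, Thm. 6.1 (symmetry clause; TeX L1355; held: Theorem 28, chunk p0014)] -/
theorem IkenmeyerPanova2017.thm_6_1_symm {d n k k' : ℕ} (hdn : d ≤ n) (hkk : k + k' + 1 = d ^ 2)
    (lam lam' : Nat.Partition (d * n))
    (hlam : lam.parts = (d * n - k) ::ₘ Multiset.replicate k 1)
    (hlam' : lam'.parts = (d * n - k') ::ₘ Multiset.replicate k' 1) :
    kroneckerCoeff ℂ lam (Nat.Partition.rectangle d n) (Nat.Partition.rectangle d n) =
      kroneckerCoeff ℂ lam' (Nat.Partition.rectangle d n) (Nat.Partition.rectangle d n) :=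
  ikenmeyerPanova2017_thm_6_1_symm ikenmeyerPanova2017_prop_6_4_holds hdn hkk lam lam' hlam hlam'

/-- **Ikenmeyer–Panova 2017, Thm. 6.1, monotonicity clause exactly as its printed proof establishes it
(`d ≥ 27`, `26 < k ≤ d²/2`), from Prop. 6.8 alone**: the tree's `ikenmeyerPanova2017_thm_6_1_mono` with
Prop. 6.4 supplied by `ikenmeyerPanova2017_prop_6_4_holds`; the remaining hypothesis `h68` is Prop. 6.8
(= Pak–Panova 2014, Thm. 5.2), a genuinely separate published input.
[cite: IkenmeyerPanova2017, Thm. 6.1 (monotonicity clause) with its proof (TeX L1355, L1438–1447; held: Theorem 28 and its proof, chunks p0014, p0016)] -/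
theorem IkenmeyerPanova2017.thm_6_1_mono_of_prop_6_8 (h68 : ikenmeyerPanova2017_prop_6_8) {d n k : ℕ}
    (hd : 27 ≤ d) (hdn : d ≤ n) (hk : 26 < k) (hk' : 2 * k ≤ d ^ 2) (lam lam'' : Nat.Partition (d * n))
    (hlam : lam.parts = (d * n - k) ::ₘ Multiset.replicate k 1)
    (hlam'' : lam''.parts = (d * n - (k - 2)) ::ₘ Multiset.replicate (k - 2) 1) :
    kroneckerCoeff ℂ lam'' (Nat.Partition.rectangle d n) (Nat.Partition.rectangle d n) <
      kroneckerCoeff ℂ lam (Nat.Partition.rectangle d n) (Nat.Partition.rectangle d n) :=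
  ikenmeyerPanova2017_thm_6_1_mono ikenmeyerPanova2017_prop_6_4_holds h68 hd hdn hk hk' lam lam'' hlam
    hlam''

/-- **The hooks of `𝔛`, unconditionally: `g((nd-k, 1^k), n × d, n × d) = 0` for `k ∈ {1, 2, 4, 6}`
and `n, d ≥ k`** — the tree's `hook_kroneckerCoeff_eq_zero_of_prop_6_4` (vanishing clause / table of
Thm. 6.1 in either orientation) with Prop. 6.4 supplied by `ikenmeyerPanova2017_prop_6_4_holds`.
[cite: IkenmeyerPanova2017, Cor. 5.1 (proof) with Thm. 6.1 (TeX L1340–1353)] -/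
theorem IkenmeyerPanova2017.hook_kroneckerCoeff_eq_zero {n d k : ℕ}
    (hk : k = 1 ∨ k = 2 ∨ k = 4 ∨ k = 6) (hkn : k ≤ n) (hkd : k ≤ d) (lam : Nat.Partition (n * d))
    (hlam : lam.parts = (n * d - k) ::ₘ Multiset.replicate k 1) :
    kroneckerCoeff ℂ lam (Nat.Partition.rectangle n d) (Nat.Partition.rectangle n d) = 0 :=
  hook_kroneckerCoeff_eq_zero_of_prop_6_4 ikenmeyerPanova2017_prop_6_4_holds hk hkn hkd lam hlam

end Literature.Computability.AlgebraicComplexity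

end
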